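import Literature.MathematicalPhysics.QuantumFieldTheory.Wightman
import Literature.Analysis.FunctionSpaces.WightmanFunctions
import Literature.Analysis.FunctionSpaces.WightmanFunctionsProofs
import Literature.MathematicalPhysics.QuantumFieldTheory.OSLorentzInvariance
import Literature.Analysis.FunctionSpaces.WightmanGNSSpectral
import Literature.MathematicalPhysics.QuantumFieldTheory.LorentzSpectralSupport
import Mathlib.Analysis.Calculus.FDeriv.RestrictScalars
import Mathlib.MeasureTheory.Measure.Haar.InnerProductSpace
import HarnessLib

/-!
# OS reconstruction (`os_reconstruction`): decomposition and assembly

`Literature.MathematicalPhysics.QuantumFieldTheory.Wightman` records the named fact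
`Literature.MathematicalPhysics.QuantumFieldTheory.os_reconstruction` (constructive-qft.S04; Osterwalder–Schrader II (1975),
Theorem E'→R'; Glimm–Jaffe (1987) Thm. 6.1.3, §19.1): a Schwinger family `S` on `ℝ^{d+1}`,
`d ≥ 1`, with `𝔖₀ = 1`, E1–E4 (`IsOSFamily`) and the linear growth condition E0'
(`HasLinearGrowth`) is the Wick rotation of a Wightman QFT of one hermitian scalar field on its
polynomial domain, unique up to unitary equivalence.

This is a theory, not a lemma (OS II, Chapters IV–VI, on top of OS I §4 and the Wightman
reconstruction theorem). This file fixes the **decomposition** along which it is proved and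
proves the **assembly**:

* (A) `OS1975_exists_wightmanFamily` — *named fact*, the analytic core of OS II, Theorem E'→R'
  read on the level of vacuum expectation values: from E0', `𝔖₀ = 1`, E1–E4 one constructs
  tempered distributions `𝒲ₙ` on `(ℝ^{1+d})^n` having the Wightman properties (a)–(f) of
  Streater–Wightman §3-3/§3-4 with `𝒲₀ = 1` (`IsWightmanFamily`), together with functions `𝔚ₙ`
  holomorphic on the forward tube `𝒯ₙ` whose distributional boundary values are the `𝒲ₙ` and
  whose values at time-ordered Euclidean points reproduce `𝔖ₙ` on `𝒮_<`
  (OS II §IV.2: Thm. 4.1 (A₀), Thm. 4.2 (A_r), Thm. 4.3, the Fourier–Laplace representation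
  and the bound (4.7) giving R0'; R1–R5 as in OS I §4.2–4.5);
* (B) `Literature.Analysis.FunctionSpaces.wightman_reconstruction` (`Literature.Analysis.FunctionSpaces.WightmanFunctions`)
  — *named fact*, the Wightman reconstruction theorem (Streater–Wightman Thm. 3-7): such a
  family is the family of Wightman distributions of a Wightman QFT on its polynomial domain,
  unique up to unitary equivalence among such;
* (C) `Literature.MathematicalPhysics.QuantumFieldTheory.wightmanFn_eq_of_isWickRotationOf` (`Wightman`) — *named fact,
  discharged* there (`wightmanFn_eq_of_isWickRotationOf_holds`): two
  Wightman data with the same Wick rotation have the same smeared Wightman functions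
  (time-ordered Euclidean points are a set of uniqueness for the forward tube);

and `os_reconstruction_of_parts : (A) → (∀ d, (B)) → (C) → os_reconstruction` (real proof:
existence from (A)+(B) — the Wick rotation of the reconstructed `W` is witnessed by the `𝔚ₙ`
of (A) and `IsWightmanDistributionOf` from (B); uniqueness from (C)+(B) — a second Wightman QFT
`W'` on its polynomial domain with Wick rotation `S` has, by (C), the same Wightman functions,
hence the `𝒲ₙ` as its Wightman distributions, so the uniqueness clause of (B) applies;
`WightmanData.HasPolynomialDomain` and `WightmanData.HasMinimalDomain` agree definitionally).
Since the uniqueness half of (B) is a theorem (`Literature.Analysis.FunctionSpaces.wightman_reconstruction_unique`,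
`Literature.Analysis.FunctionSpaces.wightman_reconstruction_of_exists` in `WightmanFunctionsProofs`) and (C) is discharged
(`wightmanFn_eq_of_isWickRotationOf_holds` in `Wightman`), the reduced assembly
`os_reconstruction_of_core : (A) → (∀ d, wightman_reconstruction_exists) → os_reconstruction`
(real proof) leaves exactly two named facts: (A) and the existence half (B₁)
`Literature.Analysis.FunctionSpaces.wightman_reconstruction_exists` of Wightman reconstruction. One level down, (A) is the
conjunction (`OS1975_exists_wightmanFamily_of_parts`, real proof) of

* (A₁₂) `OS1975_exists_forwardTube_continuation` — *named fact*, OS II §IV.2 (Thms. 4.1–4.3 and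
  the Fourier–Laplace representation, Vladimirov; OS I (4.12)–(4.13)): holomorphic `𝔚ₙ` on `𝒯ₙ`
  with tempered distributional boundary values `Tₙ` and Euclidean restriction `𝔖ₙ` on `𝒮_<`;
* (A₃) `OS1973_isWightmanFamily_of_continuation` — *named fact*, OS I §4.1 (end)–§4.5: boundary
  values so obtained have the Wightman properties (a)–(f) and `𝒲₀ = 1`;

both uniquely pinned down by `S` thanks to the identity theorem `Literature.MathematicalPhysics.QuantumFieldTheory.eqOn_forwardTube_of_euclidean`
and `Literature.MathematicalPhysics.QuantumLattice.HasDistributionalBoundaryValue.eq_of_eqOn` of `Wightman`; the `n = 0` conjunct of (A₃)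
(`𝒲₀ = 1`) is proved here as `isNormalisedFamily_of_continuation`. The bridge
`WightmanData.hasPolynomialDomain_iff_hasMinimalDomain` (`Iff.rfl`) records that the domain
predicates of `Wightman` and `WightmanFunctions` agree.

## Attacking (A₃)

The last part of the file starts the attack on (A₃) with the tools of `Wightman`: writing
`IsOSContinuationFamily S 𝒲` for its hypothesis (which pins `𝒲` down,
`IsOSContinuationFamily.unique`), it **proves translation invariance** of `𝒲` from E1
(`IsOSContinuationFamily.translateMulti_eq`: E1 at Euclidean points and the identity theorem
give invariance of `𝔚ₙ` under real spatial shifts and under the imaginary time shifts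
`z + i s ê₀`, `s ≥ 0`; the one-variable identity theorem in the complex shift parameter turns the
latter into invariance under real time shifts; a change of variables transfers this to the
boundary values), reduces property (a) to invariance under pure Lorentz transformations
(`isPoincareInvariantFamily_of_lorentz`), proves `𝒲₀ = 1`, and records the remaining conjuncts
as the named facts `OS1973_lorentzInvariant` (§4.2), `OS1973_spectralCondition` (§4.1/4.2),
`OS1973_hermitian` (p. 88), `OS1973_local` (§4.5), `OS1973_positiveDefinite` (§4.3),
`OS1973_cluster` (§4.4), assembled in `OS1973_isWightmanFamily_of_continuation_of_parts`.

## Hermiticity (discharged)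

The final part of the file **proves** `OS1973_hermitian` (`OS1973_hermitian_holds`), i.e.
property (c) for every OS continuation family, from E1 and E2 alone:
(1) *reality* `𝔖ₙ(ΘF*) = conj 𝔖ₙ(F)` for positive-time `F`
(`AQFT.SchwingerFamily.IsOSFamily.apply_osAdjoint`: E2 for the two-term sequence
`(c · 1, F)` and `c = 1, i, −i`); (2) by E1 the continuation `𝔚ₙ` is invariant under the
imaginary time shifts `z + i s ê₀`, `s ≥ 0`, hence extends (`tubeExtension`) to the *relative*
tube `{Im (z_k − z_{k-1}) ∈ V₊, k ≥ 1}` (no condition on `Im z₀`), holomorphically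
(`differentiableAt_tubeExtension`); (3) the *reflected continuation*
`𝔚†(w) = conj 𝔚ext(conj w_{n-1}, …, conj w₀)` (`reflectFn`) is holomorphic on `𝒯ₙ`
(`DifferentiableAt.conj_comp_revConj`: conjugate-linear twice), has distributional boundary
value `F ↦ conj 𝒲ₙ(F*)`, `F*(x) = conj F(xₙ, …, x₁)`
(`HasDistributionalBoundaryValue.reflectFn`: reindexing `x ↦ rev x` and the reversed base-cone
direction `revDir`), and at time-ordered Euclidean points equals `conj 𝔚(ι φₛ x)` with the
measure-preserving involution `(φₛ x)_k = θ x_{n-1-k} + s ê₀` (`thetaRevShift`), so that its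
Euclidean integrals against compactly supported time-ordered `F` are
`conj 𝔖ₙ((ΘF*)(· − s ê₀)) = conj 𝔖ₙ(ΘF*) = 𝔖ₙ(F)` by E1 and (1)
(`integral_reflectFn_euclideanPoint_mul`); (4) hence `𝔚† = 𝔚` on `𝒯ₙ` by the identity
theorem from Euclidean points (`reflectFn_eqOn`, with the compact-support variant
`eqOn_timeOrderedRegion_of_integral_eq_of_hasCompactSupport`), and uniqueness of boundary
values gives `𝒲ₙ(F*) = conj 𝒲ₙ(F)` (`HasDistributionalBoundaryValue.apply_starTest_permTest`,
`IsOSContinuationFamily.isHermitianFamily`).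

## Lorentz invariance (discharged)

`OS1973_lorentzInvariant` is **proved** (`OS1973_lorentzInvariant_holds`) on top of the worker
file `OSLorentzInvariance`: there E1 and the identity theorem on the tube give invariance of the
continuation `𝔚ₙ` under spatial isometries `1 ⊕ R`, `R ∈ O(d)` (directly at Euclidean points)
and under boosts (analytic continuation in the complex rapidity: the complex boost `B_i(iφ)` is
the Euclidean rotation by `φ` in the `(0, i)`-plane at Euclidean points), every orthochronous
Lorentz transformation is `(1 ⊕ R₁) B_i(χ) (1 ⊕ R₂)`, and tube invariance passes to the
boundary values by a unimodular change of variables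
(`Literature.MathematicalPhysics.QuantumLattice.HasDistributionalBoundaryValue.poincareTestMulti_inr_eq`). With the translation
invariance proved above this gives property (a) for every OS continuation family
(`IsOSContinuationFamily.isPoincareInvariantFamily`).

## Wightman reconstruction (discharged, `d ≥ 1`)

With `Literature.Analysis.FunctionSpaces.wightman_reconstruction_holds` (`WightmanGNSSpectral`: the GNS construction of
Streater–Wightman Thm. 3-7, fully proved for `d ≥ 1`) the named fact (B) disappears from the
hypotheses: `os_reconstruction_of_exists_wightmanFamily : OS1975_exists_wightmanFamily →
os_reconstruction`, and `os_reconstruction_of_remaining` lists exactly what is left — the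
analytic continuation (A₁₂) and the properties (b), (d), (e), (f) of the boundary values.

## The spectral condition (b), modulo the half-space support (A₁₂⁺)

OS I p. 93 derive R5 from the half-space support `{q_k⁰ ≥ 0}` of the Fourier–Laplace
representation (4.12) and Lorentz invariance; the upgrade "half-space + `L↑₊`-invariance ⇒ `V̄₊`"
is the theorem `Literature.MathematicalPhysics.QuantumFieldTheory.fourierSupportedIn_spectralSet_of_lorentzInvariant`
(`LorentzSpectralSupport`). Recording the continuation together with its half-space support as
the named fact `OS1975_exists_continuation_halfSpace` (A₁₂⁺ ⇒ A₁₂), R5 is **proved**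
(`OS1973_spectralCondition_of_halfSpace`) and `os_reconstruction_of_remaining'` needs only
(A₁₂⁺), (d), (e), (f).

## Faithfulness of (A)

OS II state Theorem E'→R' for `ℝ⁴` and for Schwinger functions given as distributions on
`⁰𝒮(ℝ^{4n})` (test functions vanishing with all derivatives at coincident points) with E1 for
`SO(4)`; H21's `SchwingerFamily`/`IsOSFamily`/`HasLinearGrowth` (fixed by the parent fact
`os_reconstruction`, whose hypotheses (A) copies verbatim) live on all of `𝒮((ℝ^{d+1})^n)` with
full `O(d+1)` invariance and the E0' bound for all Schwartz test functions — *stronger*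
hypotheses (restriction to `⁰𝒮` recovers OS's), in general dimension `d + 1 ≥ 2` exactly as the
parent fact and Glimm–Jaffe §6.1/§19.1 (the OS II arguments do not depend on `d`). The
conclusion "(a)–(f)" is Streater–Wightman's list in Thm. 3-7, i.e. OS's R1–R5 plus hermiticity,
which OS obtain through "all the Wightman axioms" (Thm. E'→R' (b)) — equivalently, by SW
Thms. 3-1–3-4, the properties of the Wightman distributions of the reconstructed theory.

## References

* K. Osterwalder, R. Schrader, *Axioms for Euclidean Green's functions II*, Comm. Math. Phys.
  42 (1975) 281–305: §IV.1, Theorem E' (or E'')→R' (p. 287); §IV.2 (pp. 288–289), Thms. 4.1–4.3,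
  eqs. (4.4)–(4.7). [OsterwalderSchraderCMP1975]
* K. Osterwalder, R. Schrader, *Axioms for Euclidean Green's functions*, Comm. Math. Phys. 31
  (1973) 83–112, §4.2–4.5. [OsterwalderSchraderCMP1973]
* R. F. Streater, A. S. Wightman, *PCT, Spin and Statistics, and All That* (1964), §3-3, §3-4,
  Thm. 3-7. [StreaterWightman1964]
* J. Glimm, A. Jaffe, *Quantum Physics* (2nd ed. 1987), Thm. 6.1.3, §19.1. [GlimmJaffeQP1987]
-/

noncomputable section

open MeasureTheory Filter Topology
open scoped SchwartzMap
open Literature.MathematicalPhysics.QuantumLattice Literature.MathematicalPhysics.QuantumFieldTheory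

namespace Literature.MathematicalPhysics.QuantumFieldTheory

/-- **Osterwalder–Schrader II, Theorem E'→R' — the Wightman distributions of an OS family**
(Osterwalder–Schrader, CMP 42 (1975), §IV.1, Theorem E' (or E'')→R', p. 287, parts (a)–(b), with
the construction of §IV.2: Thm. 4.1 (A₀, real analyticity and the temperedness estimate (4.5)),
Thm. 4.2 (A_r, analytic continuation to `C_k^{(r)}` with the bounds (4.6), the only step using
E0'), Thm. 4.3 (`⋃_r C_k^{(r)} = ℂ₊^k`), the Fourier–Laplace representation of the continued
Schwinger functions and the estimate (4.7) giving R0'; the remaining axioms R1–R5 "as in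
Sections 4.2–4.5 of OS I"). *Statement (level of vacuum expectation values).* Let `S = (𝔖ₙ)ₙ`
be a Schwinger family on Euclidean `ℝ^{d+1}`, `d ≥ 1`, with `𝔖₀ = 1`, E1–E4 (`IsOSFamily`) and
the linear growth condition E0' (`HasLinearGrowth`). Then there is a family of tempered
distributions `𝒲ₙ ∈ 𝒮'((ℝ^{1+d})^n)` (one hermitian scalar field, labels in `Unit`) with the
Wightman properties (a) Poincaré invariance, (b) spectral condition, (c) hermiticity, (d) local
commutativity, (e) positive definiteness, (f) cluster property, and `𝒲₀ = 1`
(`IsWightmanFamily`, Streater–Wightman §3-3/§3-4 — OS's R1–R5 together with hermiticity, i.e.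
"all the Wightman axioms" of Thm. E'→R' (b) read through SW Thms. 3-1–3-4), and for every `n` a
function `𝔚ₙ` holomorphic on the forward tube `𝒯ₙ` whose distributional boundary value is `𝒲ₙ`
and whose values at Euclidean points give `𝔖ₙ` on time-ordered test functions,
`𝔖ₙ(F) = ∫ 𝔚ₙ((i x_k⁰, x⃗_k)_k) F(x) dx` for `F ∈ 𝒮_<` ("is the sequence of Euclidean Green's
functions of" the theory, Thm. E'→R' (a); OS I §4, (4.12)–(4.14)). H21's hypotheses are those
of the parent fact `os_reconstruction` (Schwinger functions on all of `𝒮`, `O(d+1)`-invariance,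
general `d ≥ 1`), stronger than OS's (`⁰𝒮'`, `SO(4)`, `d = 3`); see the module docstring.
Together with the Wightman reconstruction theorem (`Literature.Analysis.FunctionSpaces.wightman_reconstruction`) and
`wightmanFn_eq_of_isWickRotationOf` this yields `os_reconstruction`
(`os_reconstruction_of_parts`). Known theorem (the analytic core of OS II); proof deferred. [cite: OsterwalderSchraderCMP1975, §IV.1 Thm. E'→R' (p. 287) and §IV.2 Thms. 4.1–4.3, (4.7)] [cite: OsterwalderSchraderCMP1973, §4.2–4.5] -/
def OS1975_exists_wightmanFamily : Prop :=
  ∀ (d : ℕ) [NeZero d] (S : SchwingerFamily (EuclideanSpace ℝ (Fin (d + 1)))),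
    S.IsOSFamily → S.HasLinearGrowth →
      ∃ 𝒲 : Literature.Analysis.FunctionSpaces.WightmanFamily d Unit, Literature.Analysis.FunctionSpaces.IsWightmanFamily 𝒲 ∧
        ∀ n : ℕ, ∃ 𝔚 : (Fin n → Fin (d + 1) → ℂ) → ℂ,
          DifferentiableOn ℂ 𝔚 (forwardTube d n) ∧
          HasDistributionalBoundaryValue 𝔚 (𝒲 n fun _ => ()) ∧
          ∀ F : 𝓢((Fin n → EuclideanSpace ℝ (Fin (d + 1))), ℂ), IsTimeOrdered F →
            S n F = ∫ x : Fin n → EuclideanSpace ℝ (Fin (d + 1)), 𝔚 (euclideanPoint x) * F x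

/-- **Assembly of `os_reconstruction`** from (A) `OS1975_exists_wightmanFamily` (OS II,
Thm. E'→R' on the level of Wightman distributions), (B) the Wightman reconstruction theorem
`Literature.Analysis.FunctionSpaces.wightman_reconstruction` (Streater–Wightman Thm. 3-7) in every space dimension `d`, and
(C) `wightmanFn_eq_of_isWickRotationOf` (uniqueness of the Wightman functions with a given
Wick rotation, discharged in `Wightman`). Existence: the QFT `W` reconstructed by (B) from the
family `𝒲` of (A) has polynomial (= minimal) domain, and `S` is its Wick rotation, witnessed by
the holomorphic `𝔚ₙ` of (A) whose boundary values `𝒲ₙ` are, by (B), the Wightman distributions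
of `W`. Uniqueness: if `W'` is a Wightman QFT on its polynomial domain with Wick rotation `S`,
then by (C) `W'` and `W` have the same smeared Wightman functions, so every `𝒲ₙ` is also the
Wightman distribution of `W'` (labels in `Unit` are unique) and the uniqueness clause of (B)
gives `W ≃ W'`. Real proof. [cite: OsterwalderSchraderCMP1975, §IV.1 Thm. E'→R'] -/
theorem os_reconstruction_of_parts (hA : OS1975_exists_wightmanFamily)
    (hB : ∀ d : ℕ, Literature.Analysis.FunctionSpaces.wightman_reconstruction (d := d))
    (hC : wightmanFn_eq_of_isWickRotationOf) : os_reconstruction := by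
  intro d _ S hS hE0'
  obtain ⟨𝒲, h𝒲, hcont⟩ := hA d S hS hE0'
  obtain ⟨W, hW, hmin, hdist, huniq⟩ := hB d h𝒲
  have hwick : IsWickRotationOf S W (fun _ _ => ()) := fun n => by
    obtain ⟨𝔚, h𝔚, hbv, hS'⟩ := hcont n
    exact ⟨𝔚, h𝔚, ⟨𝒲 n fun _ => (), hdist n _, hbv⟩, hS'⟩
  refine ⟨W, hW, hmin, hwick, fun W' hW' hmin' hwick' => huniq W' hW' hmin' fun n k => ?_⟩
  obtain rfl : k = fun _ => () := funext fun _ => rfl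
  intro f F hF
  rw [hdist n _ f F hF]
  exact hC hwick hwick' n f

/-! ### One level down: OS II's analytic continuation vs. OS I's verification of the axioms -/

/-- **(A₁₂) Osterwalder–Schrader II — analytic continuation to the forward tube with tempered
boundary values** (CMP 42 (1975), §IV.2, pp. 288–289: Thm. 4.1 (A₀), Thm. 4.2 (A_r), Thm. 4.3,
then "by standard arguments (see Vladimirov [19], p. 235 ff.) Theorem 4.3 implies that there
exist unique distributions `W̃_k ∈ 𝒮'(ℝ^{4k})` with support in `ℝ̄₊^{4k}` such that `S_k` are
the Fourier–Laplace transform of them … `W̃_k` is the Fourier transform of the difference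
variable Wightman distribution `W_k`", and the estimate (4.7); in the coordinates `x_k` this is
OS I (1973), §4.1, eqs. (4.12)–(4.13)). *Statement in H21's vocabulary.* For a Schwinger family
`S` on `ℝ^{d+1}`, `d ≥ 1`, with `𝔖₀ = 1`, E1–E4 and E0', for every `n` there are a function `𝔚ₙ`
holomorphic on the forward tube `𝒯ₙ` and a tempered distribution `Tₙ ∈ 𝒮'((ℝ^{1+d})^n)` such
that `Tₙ` is the distributional boundary value of `𝔚ₙ` (`HasDistributionalBoundaryValue`, limits
along rays `x + i t η`, `η` in the base cone) and `𝔖ₙ(F) = ∫ 𝔚ₙ((i x_k⁰, x⃗_k)_k) F(x) dx` for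
time-ordered `F` (OS I (4.12) read at Euclidean points). By `Literature.MathematicalPhysics.QuantumFieldTheory.eqOn_forwardTube_of_euclidean`
and `Literature.MathematicalPhysics.QuantumLattice.HasDistributionalBoundaryValue.eq_of_eqOn` (`Wightman`), `𝔚ₙ` and `Tₙ` are uniquely
determined by `S`. Hypotheses as in the parent fact `os_reconstruction` (stronger than OS's,
module docstring). Known theorem (the analytic part of OS II); proof deferred. [cite: OsterwalderSchraderCMP1975, §IV.2 Thms. 4.1–4.3 and (4.7), pp. 288–289] [cite: OsterwalderSchraderCMP1973, §4.1 eqs. (4.12)–(4.13)] -/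
def OS1975_exists_forwardTube_continuation : Prop :=
  ∀ (d : ℕ) [NeZero d] (S : SchwingerFamily (EuclideanSpace ℝ (Fin (d + 1)))),
    S.IsOSFamily → S.HasLinearGrowth →
      ∀ n : ℕ, ∃ (𝔚 : (Fin n → Fin (d + 1) → ℂ) → ℂ) (T : 𝓢((Fin n → SpaceTime d), ℂ) →L[ℂ] ℂ),
        DifferentiableOn ℂ 𝔚 (forwardTube d n) ∧ HasDistributionalBoundaryValue 𝔚 T ∧
          ∀ F : 𝓢((Fin n → EuclideanSpace ℝ (Fin (d + 1))), ℂ), IsTimeOrdered F →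
            S n F = ∫ x : Fin n → EuclideanSpace ℝ (Fin (d + 1)), 𝔚 (euclideanPoint x) * F x

/-- **(A₃) Osterwalder–Schrader I — the boundary values satisfy the Wightman axioms**
(CMP 31 (1973), §4: end of §4.1 (temperedness R0 and spectral condition R5 from the support of
the Laplace representation, p. 93), §4.2 (Lorentz covariance R1, from E1 by analytic
continuation, eq. (4.14)), §4.3 (positivity R2, from E2), §4.4 (cluster property R4, from E4),
§4.5 (locality R3, from symmetry E3 and Jost's theorem); hermiticity is not listed separately
by OS ("we do not list hermiticity as an extra condition", p. 88: R0–R5 "as they are given on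
p. 117 of" Streater–Wightman, i.e. the list (a)–(f) of SW Thm. 3-7); OS II (1975), §IV.2,
p. 288: "The remaining Wightman axioms can be established as in Sections 4.2–4.5 of OS I").
*Statement in H21's vocabulary.* Let `S` be a Schwinger family on `ℝ^{d+1}`, `d ≥ 1`, with
`𝔖₀ = 1`, E1–E4 and E0', and let `𝒲` be a family of tempered distributions (one scalar field)
such that each `𝒲ₙ` is the distributional boundary value of a function `𝔚ₙ` holomorphic on
`𝒯ₙ` whose Euclidean restriction is `𝔖ₙ` on time-ordered test functions — by
`Literature.MathematicalPhysics.QuantumFieldTheory.eqOn_forwardTube_of_euclidean` / `HasDistributionalBoundaryValue.eq_of_eqOn` such `𝒲` is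
unique, so this is exactly the family constructed in (A₁₂)
(`OS1975_exists_forwardTube_continuation`). Then `𝒲` has the Wightman properties (a)–(f) and
`𝒲₀ = 1` (`IsWightmanFamily`). Known theorem; proof deferred. [cite: OsterwalderSchraderCMP1973, §4.1 (p. 93, R0 and R5) and §§4.2–4.5 (R1–R4)] [cite: OsterwalderSchraderCMP1975, §IV.2 p. 288] -/
def OS1973_isWightmanFamily_of_continuation : Prop :=
  ∀ (d : ℕ) [NeZero d] (S : SchwingerFamily (EuclideanSpace ℝ (Fin (d + 1)))),
    S.IsOSFamily → S.HasLinearGrowth → ∀ 𝒲 : Literature.Analysis.FunctionSpaces.WightmanFamily d Unit,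
      (∀ n : ℕ, ∃ 𝔚 : (Fin n → Fin (d + 1) → ℂ) → ℂ,
        DifferentiableOn ℂ 𝔚 (forwardTube d n) ∧
        HasDistributionalBoundaryValue 𝔚 (𝒲 n fun _ => ()) ∧
          ∀ F : 𝓢((Fin n → EuclideanSpace ℝ (Fin (d + 1))), ℂ), IsTimeOrdered F →
            S n F = ∫ x : Fin n → EuclideanSpace ℝ (Fin (d + 1)), 𝔚 (euclideanPoint x) * F x) →
      Literature.Analysis.FunctionSpaces.IsWightmanFamily 𝒲

/-- **The `n = 0` conjunct of (A₃) is elementary.** If `𝔖₀ = 1` (`IsNormalized`) and `𝒲₀` is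
the boundary value of a function `𝔚₀` on `(ℂ^{1+d})^0` (a one-point space) whose Euclidean
"restriction" reproduces `𝔖₀`, then `𝔚₀ = 1` (test against the constant Schwartz function `1`;
Lebesgue measure on `(ℝ^{d+1})^0` is the unit point mass) and hence `𝒲₀(F) = F(pt)`, i.e.
`𝒲₀ = 1` (`IsNormalisedFamily`). Real proof; recorded to show that the hypotheses of
`OS1973_isWightmanFamily_of_continuation` are of the right shape to be attacked conjunct by
conjunct. [folklore] -/
theorem isNormalisedFamily_of_continuation {d : ℕ}
    {S : SchwingerFamily (EuclideanSpace ℝ (Fin (d + 1)))} (hS0 : S.IsNormalized)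
    {𝒲 : Literature.Analysis.FunctionSpaces.WightmanFamily d Unit} {𝔚 : (Fin 0 → Fin (d + 1) → ℂ) → ℂ}
    (hbv : HasDistributionalBoundaryValue 𝔚 (𝒲 0 fun _ => ()))
    (hS : ∀ F : 𝓢((Fin 0 → EuclideanSpace ℝ (Fin (d + 1))), ℂ), IsTimeOrdered F →
      S 0 F = ∫ x, 𝔚 (euclideanPoint x) * F x) :
    Literature.Analysis.FunctionSpaces.IsNormalisedFamily 𝒲 := by
  -- all points of `(ℂ^{1+d})^0` coincide; let `c` be the value of `𝔚` there
  set pt : Fin 0 → Fin (d + 1) → ℂ := fun k => k.elim0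
  have hpt : ∀ z : Fin 0 → Fin (d + 1) → ℂ, z = pt := fun z => Subsingleton.elim _ _
  have hvol : (volume : Measure (Fin 0 → EuclideanSpace ℝ (Fin (d + 1)))) Set.univ = 1 := by
    rw [volume_pi, ← Set.pi_univ, Measure.pi_pi]; simp
  have hint : ∀ G : (Fin 0 → EuclideanSpace ℝ (Fin (d + 1))) → ℂ,
      ∫ x, G x = G default := fun G => by
    rw [integral_unique, Measure.real, hvol]
    simp only [ENNReal.toReal_one, one_smul]
    exact congrArg G (Subsingleton.elim _ _)
  have htime : ∀ F : 𝓢((Fin 0 → EuclideanSpace ℝ (Fin (d + 1))), ℂ), IsTimeOrdered F :=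
    fun F x _ => ⟨fun i => i.elim0, Subsingleton.strictMono _⟩
  -- Step 1: `c = 1`, testing against the constant function `1`
  have hK : HasCompactSupport fun _ : Fin 0 → EuclideanSpace ℝ (Fin (d + 1)) => (1 : ℂ) :=
    (Set.subsingleton_of_subsingleton.finite).isCompact
  set F₁ : 𝓢((Fin 0 → EuclideanSpace ℝ (Fin (d + 1))), ℂ) := hK.toSchwartzMap contDiff_const
  have hc : 𝔚 pt = 1 := by
    have h1 := hS F₁ (htime F₁)
    rw [hS0, hint] at h1
    have hF₁ : F₁ default = 1 := rfl
    rw [hF₁, hpt (euclideanPoint default), mul_one] at h1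
    exact h1.symm
  -- Step 2: the boundary value of the constant `1` is evaluation
  intro k F
  obtain rfl : k = fun _ => () := funext fun _ => rfl
  have hη : (fun k : Fin 0 => (k.elim0 : SpaceTime d)) ∈ tubeCone d 0 := fun k => k.elim0
  have hlim := hbv _ hη F
  have hconst : (fun t : ℝ => ∫ x : Fin 0 → SpaceTime d,
      𝔚 (fun k => complexifyPoint (x k) + ((t : ℂ) * Complex.I) • complexifyPoint (k.elim0)) * F x)
      = fun _ => F default := by
    funext t
    rw [hint, hpt (fun k => _), hc, one_mul]
  rw [hconst] at hlim
  exact (tendsto_nhds_unique hlim tendsto_const_nhds).symm ▸ rfl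

/-- **Assembly of (A) from (A₁₂) and (A₃)**: the analytic continuation with tempered boundary
values (OS II §IV.2) and the verification of the Wightman axioms for these boundary values
(OS I §4.1–4.5) give `OS1975_exists_wightmanFamily` (take `𝒲ₙ := Tₙ`, choice over `n`).
Real proof. [cite: OsterwalderSchraderCMP1975, §IV.2] -/
theorem OS1975_exists_wightmanFamily_of_parts (hA₁₂ : OS1975_exists_forwardTube_continuation)
    (hA₃ : OS1973_isWightmanFamily_of_continuation) : OS1975_exists_wightmanFamily := by
  intro d _ S hS hE0'
  choose 𝔚 T h𝔚 hT hS' using hA₁₂ d S hS hE0'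
  refine ⟨fun n _ => T n, hA₃ d S hS hE0' _ fun n => ⟨𝔚 n, h𝔚 n, hT n, hS' n⟩,
    fun n => ⟨𝔚 n, h𝔚 n, hT n, hS' n⟩⟩

/-! ### Bridge between the two domain predicates -/

/-- `WightmanData.HasPolynomialDomain` (`Wightman`) and `WightmanData.HasMinimalDomain`
(`WightmanFunctions`) are the same predicate (both say `D = span {φ(f₁)⋯φ(fₙ) Ω}`; the two
names exist only because a prelude module cannot import a statements module). [folklore] -/
theorem _root_.Literature.MathematicalPhysics.QuantumLattice.WightmanData.hasPolynomialDomain_iff_hasMinimalDomain {d : ℕ} {κ : Type*}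
    (W : WightmanData d κ) : W.HasPolynomialDomain ↔ W.HasMinimalDomain :=
  Iff.rfl

/-! ### The reduced assembly -/

/-- **`os_reconstruction` from the two remaining named facts** (A) `OS1975_exists_wightmanFamily`
(OS II, Thm. E'→R' on the level of Wightman distributions) and (B₁)
`Literature.Analysis.FunctionSpaces.wightman_reconstruction_exists` (Streater–Wightman Thm. 3-7, existence): the uniqueness
half of Wightman reconstruction (`Literature.Analysis.FunctionSpaces.wightman_reconstruction_of_exists`,
`WightmanFunctionsProofs`) and the uniqueness of the Wightman functions with a given Wick
rotation (`wightmanFn_eq_of_isWickRotationOf_holds`, `Wightman`) are theorems. Real proof. [cite: OsterwalderSchraderCMP1975, §IV.1 Thm. E'→R'] -/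
theorem os_reconstruction_of_core (hA : OS1975_exists_wightmanFamily)
    (hB₁ : ∀ d : ℕ, Literature.Analysis.FunctionSpaces.wightman_reconstruction_exists (d := d)) : os_reconstruction :=
  os_reconstruction_of_parts hA (fun d => Literature.Analysis.FunctionSpaces.wightman_reconstruction_of_exists (hB₁ d))
    wightmanFn_eq_of_isWickRotationOf_holds

end Literature.MathematicalPhysics.QuantumFieldTheory

/-! ## Attacking (A₃): translation invariance from E1, and the split of (A₃) per axiom

### Diagonal shifts of complex configurations -/

namespace Literature.MathematicalPhysics.QuantumFieldTheory

open Complex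

variable {d n : ℕ}

/-! ### Euclidean and real diagonal shifts of complex configurations -/

/-- `euclideanPoint` is additive. [folklore] -/
theorem euclideanPoint_add (x y : Fin n → EuclideanSpace ℝ (Fin (d + 1))) :
    euclideanPoint (x + y) = euclideanPoint x + euclideanPoint y := by
  funext k μ
  by_cases hμ : μ = 0
  · subst hμ; simp only [euclideanPoint_apply_zero, Pi.add_apply, PiLp.add_apply]; push_cast; ring
  · simp only [euclideanPoint, hμ, if_false, Pi.add_apply, PiLp.add_apply]; push_cast; rfl

/-- `complexifyPoint` is additive. [folklore] -/
theorem complexifyPoint_add (a b : SpaceTime d) :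
    complexifyPoint (a + b) = complexifyPoint a + complexifyPoint b := by
  ext μ; simp

/-- `complexifyPoint` commutes with real scalars. [folklore] -/
theorem complexifyPoint_smul (t : ℝ) (a : SpaceTime d) :
    complexifyPoint (t • a) = (t : ℂ) • complexifyPoint a := by
  ext μ; simp

/-- For a purely spatial vector `b` (`b⁰ = 0`) the Euclidean and the real embeddings of the
diagonal shift agree: `ι(b, …, b) = (b, …, b)`. [folklore] -/
theorem euclideanPoint_const_of_spatial {b : EuclideanSpace ℝ (Fin (d + 1))} (hb : b 0 = 0) :
    (euclideanPoint fun _ : Fin n => b) = fun _ => complexifyPoint b := by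
  funext k μ
  by_cases hμ : μ = 0
  · subst hμ; simp [hb]
  · simp [euclideanPoint, hμ]

/-- The Euclidean time shift by `s` is the imaginary Minkowski time shift `i s ê₀`,
`ê₀ = (1, 0, …, 0)`. [folklore] -/
theorem euclideanPoint_const_single (s : ℝ) :
    (euclideanPoint fun _ : Fin n => (EuclideanSpace.single 0 s : EuclideanSpace ℝ (Fin (d + 1)))) =
      fun _ => ((s : ℂ) * I) • complexifyPoint (e₀ d) := by
  funext k μ
  by_cases hμ : μ = 0
  · subst hμ; simp [e₀, mul_comm]
  · simp [euclideanPoint, hμ, e₀]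

/-- Adding a real diagonal shift does not change the imaginary parts of successive differences. [folklore] -/
theorem imPart_succDiff_add_const_real (z : Fin n → Fin (d + 1) → ℂ) (a : SpaceTime d) (k : Fin n) :
    imPart (succDiff (z + fun _ => complexifyPoint a) k) = imPart (succDiff z k) := by
  rw [succDiff_add, imPart_add]
  cases n with
  | zero => exact k.elim0
  | succ m =>
    refine Fin.cases ?_ (fun j => ?_) k
    · simp
    · simp

/-- The forward tube is invariant under real diagonal translations (Streater–Wightman (1964),
§2-4: `𝒯ₙ = ℝ^{4n} + i Γ`). [cite: StreaterWightman1964, §2-4] -/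
theorem add_const_real_mem_forwardTube {z : Fin n → Fin (d + 1) → ℂ} (hz : z ∈ forwardTube d n)
    (a : SpaceTime d) : (z + fun _ => complexifyPoint a) ∈ forwardTube d n :=
  fun k => by rw [imPart_succDiff_add_const_real]; exact hz k

/-- `V₊ + t e₀ ⊆ V₊` for `t ≥ 0`. [folklore] -/
theorem add_smul_e₀_mem_forwardCone {p : SpaceTime d} (hp : p ∈ forwardCone d) {t : ℝ}
    (ht : 0 ≤ t) : p + t • e₀ d ∈ forwardCone d := by
  rw [mem_forwardCone_iff_norm_lt] at hp ⊢
  have h1 : spaceC d (p + t • e₀ d) = spaceC d p := by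
    ext i; simp [e₀, Fin.succ_ne_zero]
  have h2 : (p + t • e₀ d) 0 = p 0 + t := by simp [e₀]
  rw [h1, h2]
  linarith

/-- The forward tube is invariant under the imaginary time shift `z ↦ z + i s ê₀`, `s ≥ 0` (the
complexified Euclidean time translation; only `Im z₀ ∈ V₊` moves, within `V₊`). [folklore] -/
theorem add_euclideanTimeShift_mem_forwardTube {z : Fin n → Fin (d + 1) → ℂ}
    (hz : z ∈ forwardTube d n) {s : ℝ} (hs : 0 ≤ s) :
    (z + euclideanPoint fun _ : Fin n =>
      (EuclideanSpace.single 0 s : EuclideanSpace ℝ (Fin (d + 1)))) ∈ forwardTube d n := by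
  intro k
  rw [succDiff_add, imPart_add]
  cases n with
  | zero => exact k.elim0
  | succ m =>
    revert k
    refine Fin.cases ?_ (fun j => ?_)
    · simp only [succDiff_zero, imPart_euclideanPoint]
      simpa using add_smul_e₀_mem_forwardCone (hz 0) hs
    · have : imPart (succDiff (euclideanPoint fun _ : Fin (m + 1) =>
          (EuclideanSpace.single 0 s : EuclideanSpace ℝ (Fin (d + 1)))) j.succ) = 0 := by
        rw [succDiff_succ, imPart_sub]; simp
      rw [this, add_zero]
      exact hz j.succ

/-! ### Translation invariance of the boundary values from E1 -/

section TranslationInvariance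

variable {S : SchwingerFamily (EuclideanSpace ℝ (Fin (d + 1)))} {𝔚 : (Fin n → Fin (d + 1) → ℂ) → ℂ}

/-- **Euclidean translations act trivially on the continued Schwinger function.** If `𝔖ₙ` is
invariant under the diagonal Euclidean translation by `b`, `𝔚` is holomorphic on `𝒯ₙ` with
Euclidean restriction `𝔖ₙ` on `𝒮_<`, and the complexified translation `z ↦ z + ι(b)`
(`ι = euclideanPoint`) maps `𝒯ₙ` into itself and time-ordered test functions to time-ordered
ones, then `𝔚 (z + ι(b)) = 𝔚 z` on `𝒯ₙ` (both sides are holomorphic with the same Euclidean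
integrals — change of variables and E1 — so `eqOn_timeOrderedRegion_of_integral_eq` and
`eqOn_forwardTube_of_euclidean` apply). [folklore] -/
theorem eqOn_forwardTube_add_euclideanShift (b : EuclideanSpace ℝ (Fin (d + 1)))
    (hE1 : ∀ F : 𝓢((Fin n → EuclideanSpace ℝ (Fin (d + 1))), ℂ), S n (translateMulti b F) = S n F)
    (h𝔚 : DifferentiableOn ℂ 𝔚 (forwardTube d n))
    (hS : ∀ F : 𝓢((Fin n → EuclideanSpace ℝ (Fin (d + 1))), ℂ), IsTimeOrdered F →
      S n F = ∫ x, 𝔚 (euclideanPoint x) * F x)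
    (hmaps : Set.MapsTo (fun z => z + euclideanPoint fun _ : Fin n => b) (forwardTube d n)
      (forwardTube d n))
    (htime : ∀ F : 𝓢((Fin n → EuclideanSpace ℝ (Fin (d + 1))), ℂ), IsTimeOrdered F →
      IsTimeOrdered (translateMulti b F)) :
    ∀ z ∈ forwardTube d n, 𝔚 (z + euclideanPoint fun _ : Fin n => b) = 𝔚 z := by
  set c : Fin n → EuclideanSpace ℝ (Fin (d + 1)) := fun _ => b with hc
  have hdiff : DifferentiableOn ℂ (fun z => 𝔚 (z + euclideanPoint c)) (forwardTube d n) :=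
    h𝔚.comp (differentiableOn_id.add (differentiableOn_const _)) hmaps
  refine eqOn_forwardTube_of_euclidean hdiff h𝔚 fun x hx => ?_
  -- equality at time-ordered Euclidean points from equality of the Euclidean integrals
  have hcont : ∀ {G : (Fin n → Fin (d + 1) → ℂ) → ℂ}, DifferentiableOn ℂ G (forwardTube d n) →
      ContinuousOn (fun x => G (euclideanPoint x)) (timeOrderedRegion d n) := fun hG =>
    hG.continuousOn.comp continuous_euclideanPoint.continuousOn
      mapsTo_euclideanPoint_timeOrderedRegion
  refine eqOn_timeOrderedRegion_of_integral_eq (hcont hdiff) (hcont h𝔚) (fun F hF => ?_) hx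
  calc ∫ x, 𝔚 (euclideanPoint x + euclideanPoint c) * F x
      = ∫ x, (fun y => 𝔚 (euclideanPoint y) * F (y - c)) (x + c) := by
        congr 1; funext x; simp only [euclideanPoint_add, add_sub_cancel_right]
    _ = ∫ y, 𝔚 (euclideanPoint y) * F (y - c) :=
        integral_add_right_eq_self (μ := volume) (fun y => 𝔚 (euclideanPoint y) * F (y - c)) c
    _ = ∫ y, 𝔚 (euclideanPoint y) * translateMulti b F y := by rfl
    _ = S n F := by rw [← hS _ (htime F hF), hE1]
    _ = ∫ y, 𝔚 (euclideanPoint y) * F y := hS F hF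

/-- Euclidean translations with nonnegative time component preserve time-ordering of test
functions (`tsupport (F(· − b)) = tsupport F + b`). [folklore] -/
theorem _root_.Literature.MathematicalPhysics.QuantumLattice.IsTimeOrdered.translateMulti_of_nonneg
    {F : 𝓢((Fin n → EuclideanSpace ℝ (Fin (d + 1))), ℂ)} (hF : IsTimeOrdered F)
    {b : EuclideanSpace ℝ (Fin (d + 1))} (hb : 0 ≤ b 0) : IsTimeOrdered (translateMulti b F) := by
  intro x hx
  set c : Fin n → EuclideanSpace ℝ (Fin (d + 1)) := fun _ => b
  have hx' : x - c ∈ tsupport (F : (Fin n → EuclideanSpace ℝ (Fin (d + 1))) → ℂ) := by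
    have hcomp : ((translateMulti b F : 𝓢(_, ℂ)) : (Fin n → EuclideanSpace ℝ (Fin (d + 1))) → ℂ)
        = (F : (Fin n → EuclideanSpace ℝ (Fin (d + 1))) → ℂ) ∘ (Homeomorph.subRight c) := by
      funext y; rfl
    rw [hcomp, tsupport_comp_eq_preimage] at hx
    exact hx
  obtain ⟨hpos, hmono⟩ := hF hx'
  refine ⟨fun i => ?_, fun i j hij => ?_⟩
  · have := hpos i
    simp only [Pi.sub_apply, PiLp.sub_apply, sub_pos, c] at this
    linarith
  · have := hmono hij
    simp only [Pi.sub_apply, PiLp.sub_apply, c] at this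
    linarith

/-- **Real time translations act trivially on the continued Schwinger function**: invariance
under the imaginary time shifts `z ↦ z + i s ê₀`, `s ≥ 0`, propagates to all complex shifts
`z + w ê₀` keeping `z` in `𝒯ₙ` by the one-variable identity theorem in `w` (the admissible `w`
form an open convex set containing `0`, `i ℝ₊` and `ℝ`), in particular to real time shifts. [folklore] -/
theorem eqOn_forwardTube_add_realTimeShift (h𝔚 : DifferentiableOn ℂ 𝔚 (forwardTube d n))
    (hA : ∀ s : ℝ, 0 ≤ s → ∀ z ∈ forwardTube d n,
      𝔚 (z + euclideanPoint fun _ : Fin n =>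
        (EuclideanSpace.single 0 s : EuclideanSpace ℝ (Fin (d + 1)))) = 𝔚 z)
    (t : ℝ) : ∀ z ∈ forwardTube d n, 𝔚 (z + fun _ => complexifyPoint (t • e₀ d)) = 𝔚 z := by
  intro z hz
  set E : Fin n → Fin (d + 1) → ℂ := fun _ => complexifyPoint (e₀ d) with hE
  set γ : ℂ → (Fin n → Fin (d + 1) → ℂ) := fun w => z + w • E with hγ
  have hγd : Differentiable ℂ γ := (differentiable_const _).add (differentiable_id.smul_const _)
  set D : Set ℂ := γ ⁻¹' forwardTube d n with hD
  have hDo : IsOpen D := isOpen_forwardTube.preimage hγd.continuous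
  have hDc : Convex ℝ D := by
    intro s hs u hu a b ha hb hab
    show γ (a • s + b • u) ∈ forwardTube d n
    have hab' : (a : ℂ) + b = 1 := by exact_mod_cast hab
    have : γ (a • s + b • u) = a • γ s + b • γ u := by
      funext k μ
      simp only [hγ, Pi.add_apply, Pi.smul_apply, smul_eq_mul, Complex.real_smul]
      linear_combination (z k μ) * hab'.symm
    rw [this]
    exact convex_forwardTube hs hu ha hb hab
  have hγr : ∀ r : ℝ, γ r = z + fun _ => complexifyPoint (r • e₀ d) := fun r => by
    funext k; simp only [hγ, hE, Pi.add_apply, Pi.smul_apply, complexifyPoint_smul]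
  have hreal_mem : ∀ r : ℝ, γ r ∈ forwardTube d n := fun r => by
    rw [hγr]; exact add_const_real_mem_forwardTube hz _
  have h0D : (0 : ℂ) ∈ D := by
    have h := hreal_mem 0
    rw [ofReal_zero] at h
    exact h
  have himag : ∀ s : ℝ, 0 ≤ s → γ ((s : ℂ) * I) ∈ forwardTube d n ∧ 𝔚 (γ ((s : ℂ) * I)) = 𝔚 z := by
    intro s hs
    have : γ ((s : ℂ) * I) = z + euclideanPoint fun _ : Fin n =>
        (EuclideanSpace.single 0 s : EuclideanSpace ℝ (Fin (d + 1))) := by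
      rw [euclideanPoint_const_single]
      funext k; simp only [hγ, hE, Pi.add_apply, Pi.smul_apply]
    rw [this]
    exact ⟨add_euclideanTimeShift_mem_forwardTube hz hs, hA s hs z hz⟩
  -- the difference `w ↦ 𝔚 (γ w) - 𝔚 z` is analytic on `D` and vanishes on `i ℝ₊`
  have hφ : AnalyticOnNhd ℂ (fun w => 𝔚 (γ w) - 𝔚 z) D :=
    ((h𝔚.comp hγd.differentiableOn (Set.mapsTo_preimage γ _)).sub
      (differentiableOn_const _)).analyticOnNhd hDo
  have hfreq : ∃ᶠ w in 𝓝[≠] (0 : ℂ), 𝔚 (γ w) - 𝔚 z = 0 := by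
    have htend : Tendsto (fun s : ℝ => (s : ℂ) * I) (𝓝[>] 0) (𝓝[≠] 0) := by
      have hc : Continuous fun s : ℝ => (s : ℂ) * I := continuous_ofReal.mul continuous_const
      have h1 : Tendsto (fun s : ℝ => (s : ℂ) * I) (𝓝[>] 0) (𝓝[{0}ᶜ] (((0 : ℝ) : ℂ) * I)) :=
        hc.continuousWithinAt.tendsto_nhdsWithin fun s hs =>
          mul_ne_zero (ofReal_ne_zero.2 (ne_of_gt hs)) I_ne_zero
      simpa using h1
    refine htend.frequently (Filter.Eventually.frequently ?_)
    refine eventually_nhdsWithin_of_forall fun s (hs : 0 < s) => ?_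
    rw [(himag s hs.le).2, sub_self]
  have hzero := hφ.eqOn_zero_of_preconnected_of_frequently_eq_zero hDc.isPreconnected h0D hfreq
    (show (t : ℂ) ∈ D from hreal_mem t)
  rw [← hγr t]
  simpa [sub_eq_zero] using hzero

/-- **Real diagonal translations act trivially on the continued Schwinger functions** under E1
(spatial part directly at Euclidean points, `eqOn_forwardTube_add_euclideanShift`; temporal
part through the imaginary time shifts and the identity theorem,
`eqOn_forwardTube_add_realTimeShift`). [folklore] -/
theorem eqOn_forwardTube_add_real (hE1 : S.IsEuclideanCovariant)
    (h𝔚 : DifferentiableOn ℂ 𝔚 (forwardTube d n))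
    (hS : ∀ F : 𝓢((Fin n → EuclideanSpace ℝ (Fin (d + 1))), ℂ), IsTimeOrdered F →
      S n F = ∫ x, 𝔚 (euclideanPoint x) * F x)
    (a : SpaceTime d) : ∀ z ∈ forwardTube d n, 𝔚 (z + fun _ => complexifyPoint a) = 𝔚 z := by
  -- spatial part
  set asp : SpaceTime d := a - (a 0) • e₀ d with hasp
  have hasp0 : asp 0 = 0 := by simp [hasp, e₀]
  have hsp : ∀ z ∈ forwardTube d n, 𝔚 (z + fun _ => complexifyPoint asp) = 𝔚 z := by
    have hmaps : Set.MapsTo (fun z => z + euclideanPoint fun _ : Fin n => asp) (forwardTube d n)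
        (forwardTube d n) := fun z hz => by
      rw [euclideanPoint_const_of_spatial hasp0]; exact add_const_real_mem_forwardTube hz asp
    have := eqOn_forwardTube_add_euclideanShift asp (fun F => hE1.translateMulti n asp F) h𝔚 hS
      hmaps (fun F hF => hF.translateMulti_of_nonneg hasp0.symm.le)
    simpa only [euclideanPoint_const_of_spatial hasp0] using this
  -- temporal part
  have htm : ∀ t : ℝ, ∀ z ∈ forwardTube d n, 𝔚 (z + fun _ => complexifyPoint (t • e₀ d)) = 𝔚 z := by
    refine eqOn_forwardTube_add_realTimeShift h𝔚 fun s hs => ?_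
    refine eqOn_forwardTube_add_euclideanShift _ (fun F => hE1.translateMulti n _ F) h𝔚 hS
      (fun z hz => add_euclideanTimeShift_mem_forwardTube hz hs) (fun F hF => ?_)
    exact hF.translateMulti_of_nonneg (by simpa using hs)
  intro z hz
  have hdecomp : (fun _ : Fin n => complexifyPoint a) =
      (fun _ => complexifyPoint asp) + fun _ => complexifyPoint ((a 0) • e₀ d) := by
    funext k
    simp only [Pi.add_apply, ← complexifyPoint_add, hasp, sub_add_cancel]
  rw [hdecomp, ← add_assoc, htm (a 0) _ (add_const_real_mem_forwardTube hz asp), hsp z hz]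

/-- **Translation invariance of the boundary values from E1** (Osterwalder–Schrader I (1973),
§4.2, first sentence: "Translation invariance of `𝔚ₙ` follows from definition (4.13)"; here from
E1 through the identity theorem on the forward tube): if `𝔖ₙ` is Euclidean covariant, `𝔚` is
holomorphic on `𝒯ₙ` with Euclidean restriction `𝔖ₙ` on `𝒮_<` and distributional boundary value
`T`, then `T` is invariant under all space-time translations (change of variables in the
approximating integrals `∫ 𝔚(x + a + itη) F(x) dx` and `eqOn_forwardTube_add_real`). [cite: OsterwalderSchraderCMP1973, §4.2 (translation invariance)] -/
theorem _root_.Literature.MathematicalPhysics.QuantumLattice.HasDistributionalBoundaryValue.translateMulti_eq (hE1 : S.IsEuclideanCovariant)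
    (h𝔚 : DifferentiableOn ℂ 𝔚 (forwardTube d n)) {T : 𝓢((Fin n → SpaceTime d), ℂ) →L[ℂ] ℂ}
    (hT : HasDistributionalBoundaryValue 𝔚 T)
    (hS : ∀ F : 𝓢((Fin n → EuclideanSpace ℝ (Fin (d + 1))), ℂ), IsTimeOrdered F →
      S n F = ∫ x, 𝔚 (euclideanPoint x) * F x)
    (a : SpaceTime d) (F : 𝓢((Fin n → SpaceTime d), ℂ)) : T (translateMulti a F) = T F := by
  have hC := eqOn_forwardTube_add_real hE1 h𝔚 hS a
  set η₀ : Fin n → SpaceTime d := fun k => (((k : ℕ) : ℝ) + 1) • e₀ d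
  have hη₀ : η₀ ∈ tubeCone d n := stdDirection_mem_tubeCone
  refine tendsto_nhds_unique_of_eventuallyEq (hT η₀ hη₀ (translateMulti a F)) (hT η₀ hη₀ F) ?_
  refine eventually_nhdsWithin_of_forall fun t (ht : 0 < t) => ?_
  set c : Fin n → SpaceTime d := fun _ => a with hc
  set P : (Fin n → SpaceTime d) → Fin n → Fin (d + 1) → ℂ :=
    fun x k => complexifyPoint (x k) + ((t : ℂ) * I) • complexifyPoint (η₀ k) with hP
  show ∫ x, 𝔚 (P x) * translateMulti a F x = ∫ x, 𝔚 (P x) * F x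
  have hPadd : ∀ y, P (y + c) = P y + fun _ => complexifyPoint a := fun y => by
    funext k
    simp only [hP, Pi.add_apply, complexifyPoint_add, hc]
    abel
  calc ∫ x, 𝔚 (P x) * translateMulti a F x
      = ∫ x, (fun y => 𝔚 (P (y + c)) * F y) (x - c) := by
        congr 1; funext x; simp only [sub_add_cancel]; rfl
    _ = ∫ y, 𝔚 (P (y + c)) * F y :=
        integral_sub_right_eq_self (μ := volume) (fun y => 𝔚 (P (y + c)) * F y) c
    _ = ∫ y, 𝔚 (P y) * F y := by
        congr 1; funext y
        rw [hPadd, hC _ (mem_forwardTube_of_mem_tubeCone y η₀ hη₀ ht)]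

end TranslationInvariance

end Literature.MathematicalPhysics.QuantumFieldTheory

namespace Literature.MathematicalPhysics.QuantumFieldTheory

/-! ### The common hypothesis of the (A₃)-facts -/

/-- **`𝒲` is the boundary-value family of an OS continuation of `S`**: for every `n` there is a
function `𝔚ₙ` holomorphic on the forward tube `𝒯ₙ` whose distributional boundary value is `𝒲ₙ`
and whose values at Euclidean points give `𝔖ₙ` on time-ordered test functions (OS I (1973), §4.1,
eqs. (4.12)–(4.13); OS II (1975), §IV.2). This is literally the hypothesis of
`OS1973_isWightmanFamily_of_continuation` (`isWightmanFamily_of_continuation_iff`) and the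
conclusion of `OS1975_exists_forwardTube_continuation`; by `Literature.MathematicalPhysics.QuantumFieldTheory.eqOn_forwardTube_of_euclidean`
and `Literature.MathematicalPhysics.QuantumLattice.HasDistributionalBoundaryValue.eq_of_eqOn` it determines `𝒲` uniquely from `S`
(`IsOSContinuationFamily.unique`). [cite: OsterwalderSchraderCMP1973, §4.1 eqs. (4.12)–(4.13)] -/
def IsOSContinuationFamily {d : ℕ} (S : SchwingerFamily (EuclideanSpace ℝ (Fin (d + 1))))
    (𝒲 : Literature.Analysis.FunctionSpaces.WightmanFamily d Unit) : Prop :=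
  ∀ n : ℕ, ∃ 𝔚 : (Fin n → Fin (d + 1) → ℂ) → ℂ,
    DifferentiableOn ℂ 𝔚 (forwardTube d n) ∧
    HasDistributionalBoundaryValue 𝔚 (𝒲 n fun _ => ()) ∧
      ∀ F : 𝓢((Fin n → EuclideanSpace ℝ (Fin (d + 1))), ℂ), IsTimeOrdered F →
        S n F = ∫ x : Fin n → EuclideanSpace ℝ (Fin (d + 1)), 𝔚 (euclideanPoint x) * F x

/-- (A₃) restated through `IsOSContinuationFamily` (definitional). [folklore] -/
theorem isWightmanFamily_of_continuation_iff :
    OS1973_isWightmanFamily_of_continuation ↔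
      ∀ (d : ℕ) [NeZero d] (S : SchwingerFamily (EuclideanSpace ℝ (Fin (d + 1)))),
        S.IsOSFamily → S.HasLinearGrowth → ∀ 𝒲 : Literature.Analysis.FunctionSpaces.WightmanFamily d Unit,
          IsOSContinuationFamily S 𝒲 → Literature.Analysis.FunctionSpaces.IsWightmanFamily 𝒲 :=
  Iff.rfl

variable {d : ℕ} {S : SchwingerFamily (EuclideanSpace ℝ (Fin (d + 1)))} {𝒲 𝒲' : Literature.Analysis.FunctionSpaces.WightmanFamily d Unit}

/-- Labels in `Unit` are unique. [folklore] -/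
theorem unitLabels_eq {n : ℕ} (k : Fin n → Unit) : k = fun _ => () := funext fun _ => rfl

/-- **The OS continuation family is unique**: two boundary-value families of OS continuations
of the same `S` coincide (identity theorem on the tube from Euclidean points and uniqueness of
boundary values, `Wightman`). Real proof. [folklore] -/
theorem IsOSContinuationFamily.unique (h : IsOSContinuationFamily S 𝒲)
    (h' : IsOSContinuationFamily S 𝒲') : 𝒲 = 𝒲' := by
  funext n k
  obtain rfl := unitLabels_eq k
  obtain ⟨𝔚, h𝔚, hbv, hS⟩ := h n
  obtain ⟨𝔚', h𝔚', hbv', hS'⟩ := h' n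
  have hE : Set.EqOn (fun x => 𝔚 (euclideanPoint x)) (fun x => 𝔚' (euclideanPoint x))
      (timeOrderedRegion d n) := by
    refine eqOn_timeOrderedRegion_of_integral_eq
      (h𝔚.continuousOn.comp continuous_euclideanPoint.continuousOn
        mapsTo_euclideanPoint_timeOrderedRegion)
      (h𝔚'.continuousOn.comp continuous_euclideanPoint.continuousOn
        mapsTo_euclideanPoint_timeOrderedRegion) fun F hF => ?_
    rw [← hS F hF, ← hS' F hF]
  exact hbv.eq_of_eqOn hbv' (eqOn_forwardTube_of_euclidean h𝔚 h𝔚' hE)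

/-- **𝒲₀ = 1 for an OS continuation family** (from `𝔖₀ = 1`; `isNormalisedFamily_of_continuation`).
Real proof. [folklore] -/
theorem IsOSContinuationFamily.isNormalisedFamily (hS0 : S.IsNormalized)
    (h : IsOSContinuationFamily S 𝒲) : Literature.Analysis.FunctionSpaces.IsNormalisedFamily 𝒲 := by
  obtain ⟨𝔚, _, hbv, hS⟩ := h 0
  exact isNormalisedFamily_of_continuation hS0 hbv hS

/-- **Translation invariance of an OS continuation family from E1** (Osterwalder–Schrader I
(1973), §4.2, first sentence; here `Literature.MathematicalPhysics.QuantumLattice.HasDistributionalBoundaryValue.translateMulti_eq`: E1 at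
Euclidean points, the identity theorem on `𝒯ₙ` for the spatial part, and the one-variable
identity theorem in the complex time shift for the temporal part). Real proof. [cite: OsterwalderSchraderCMP1973, §4.2 (translation invariance)] -/
theorem IsOSContinuationFamily.translateMulti_eq (hE1 : S.IsEuclideanCovariant)
    (h : IsOSContinuationFamily S 𝒲) (n : ℕ) (k : Fin n → Unit) (a : SpaceTime d)
    (F : 𝓢((Fin n → SpaceTime d), ℂ)) : 𝒲 n k (translateMulti a F) = 𝒲 n k F := by
  obtain rfl := unitLabels_eq k
  obtain ⟨𝔚, h𝔚, hbv, hS⟩ := h n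
  exact hbv.translateMulti_eq hE1 h𝔚 hS a F

/-- **Poincaré invariance from Lorentz invariance** for an OS continuation family: every
element of the restricted Poincaré group is `(a, 1) · (0, Λ)`, translations act trivially by
`IsOSContinuationFamily.translateMulti_eq`, so invariance under the pure Lorentz
transformations `(0, Λ)`, `Λ ∈ L↑₊`, already gives property (a) `IsPoincareInvariantFamily`.
Real proof. [folklore] -/
theorem IsOSContinuationFamily.isPoincareInvariantFamily_of_lorentz (hE1 : S.IsEuclideanCovariant)
    (h : IsOSContinuationFamily S 𝒲)
    (hΛ : ∀ (Λ : restrictedLorentzGroup d) (n : ℕ) (k : Fin n → Unit)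
      (F : 𝓢((Fin n → SpaceTime d), ℂ)),
      𝒲 n k (poincareTestMulti n (SemidirectProduct.inr Λ) F) = 𝒲 n k F) :
    Literature.Analysis.FunctionSpaces.IsPoincareInvariantFamily 𝒲 := by
  intro g n k F
  rw [← SemidirectProduct.inl_left_mul_inr_right g, poincareTestMulti_mul,
    ContinuousLinearMap.comp_apply]
  have hinl : (SemidirectProduct.inl g.left : PoincareGroup d) =
      SemidirectProduct.inl (Multiplicative.ofAdd (Multiplicative.toAdd g.left)) := rfl
  rw [hinl, Literature.Analysis.FunctionSpaces.poincareTestMulti_inl, h.translateMulti_eq hE1, hΛ]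

/-! ### (A₃) split per Wightman axiom (named facts) and its assembly -/

/-- **(A₃, R1) Lorentz invariance of the OS boundary values** (Osterwalder–Schrader I (1973),
§4.2, "Lorentz Covariance and Spectrum Condition", eqs. (4.14)–(4.15): the infinitesimal
generators `X_{ij}` of `L↑₊` annihilate `W̃ₙ`, from the restricted `SO₄` invariance (4.2) of
the difference-variable Schwinger functions). For an OS family `S` with E0' and its (unique)
continuation family `𝒲` (`IsOSContinuationFamily`), `𝒲ₙ` is invariant under the diagonal
action of every restricted Lorentz transformation `Λ ∈ L↑₊` (`poincareTestMulti n (0, Λ)`).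
Together with the proved translation invariance this is property (a)
(`IsOSContinuationFamily.isPoincareInvariantFamily_of_lorentz`). Known theorem; proof deferred. [cite: OsterwalderSchraderCMP1973, §4.2 eqs. (4.14)–(4.15)] -/
def OS1973_lorentzInvariant : Prop :=
  ∀ (d : ℕ) [NeZero d] (S : SchwingerFamily (EuclideanSpace ℝ (Fin (d + 1)))),
    S.IsOSFamily → S.HasLinearGrowth → ∀ 𝒲 : Literature.Analysis.FunctionSpaces.WightmanFamily d Unit, IsOSContinuationFamily S 𝒲 →
      ∀ (Λ : restrictedLorentzGroup d) (n : ℕ) (k : Fin n → Unit)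
        (F : 𝓢((Fin n → SpaceTime d), ℂ)),
        𝒲 n k (poincareTestMulti n (SemidirectProduct.inr Λ) F) = 𝒲 n k F

/-- **(A₃, R5) Spectral condition for the OS boundary values** (Osterwalder–Schrader I (1973),
§4.1, p. 93: "`W̃ₙ(q₁, …, qₙ)` is a distribution … with support in `{q_k⁰ ≥ 0}`. In Section 4.2
we prove that for `Λ ∈ L`, `W̃ₙ(Λq₁, …, Λqₙ) = W̃ₙ(q₁, …, qₙ)`. Hence the support of `W̃ₙ` is in
`{q_k ∈ V̄₊}` … This is the spectrum condition (R5)"). For an OS family `S` with E0' and its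
continuation family `𝒲`, property (b) `HasSpectralCondition` (Streater–Wightman (3-13), in the
sign convention fixed in `WightmanFunctions`). Known theorem; proof deferred. [cite: OsterwalderSchraderCMP1973, §4.1 p. 93 (R5) and §4.2] -/
def OS1973_spectralCondition : Prop :=
  ∀ (d : ℕ) [NeZero d] (S : SchwingerFamily (EuclideanSpace ℝ (Fin (d + 1)))),
    S.IsOSFamily → S.HasLinearGrowth → ∀ 𝒲 : Literature.Analysis.FunctionSpaces.WightmanFamily d Unit, IsOSContinuationFamily S 𝒲 →
      Literature.Analysis.FunctionSpaces.HasSpectralCondition 𝒲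

/-- **(A₃, hermiticity) Hermiticity of the OS boundary values** (Osterwalder–Schrader I (1973),
p. 88: the Wightman axioms R0–R5 "as they are given on p. 117 of" Streater–Wightman, "we do not
list hermiticity as an extra condition, because we do not have to make a distinction between
linear and nonlinear conditions" — hermiticity (SW Thm. 3-7 (c), eq. (3-45)) is part of the
axioms established by Theorem E→R / E'→R'). For an OS family `S` with E0' and its continuation
family `𝒲`, property (c) `IsHermitianFamily`. Known theorem; *discharged* below
(`OS1973_hermitian_holds`, from E1 and E2 alone). [cite: OsterwalderSchraderCMP1973, §3 p. 88 (R0–R5 incl. hermiticity)] [cite: StreaterWightman1964, §3-4 Thm. 3-7 (c)] -/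
def OS1973_hermitian : Prop :=
  ∀ (d : ℕ) [NeZero d] (S : SchwingerFamily (EuclideanSpace ℝ (Fin (d + 1)))),
    S.IsOSFamily → S.HasLinearGrowth → ∀ 𝒲 : Literature.Analysis.FunctionSpaces.WightmanFamily d Unit, IsOSContinuationFamily S 𝒲 →
      Literature.Analysis.FunctionSpaces.IsHermitianFamily 𝒲

/-- **(A₃, R3) Locality of the OS boundary values** (Osterwalder–Schrader I (1973), §4.5,
"Locality": from symmetry E3 of the Schwinger functions and the theorem of Jost's book
[12, p. 83] on functions holomorphic in the permuted extended tube). For an OS family `S` with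
E0' and its continuation family `𝒲`, property (d) `IsLocalFamily`. Known theorem; proof
deferred. [cite: OsterwalderSchraderCMP1973, §4.5 (R3 from E3)] -/
def OS1973_local : Prop :=
  ∀ (d : ℕ) [NeZero d] (S : SchwingerFamily (EuclideanSpace ℝ (Fin (d + 1)))),
    S.IsOSFamily → S.HasLinearGrowth → ∀ 𝒲 : Literature.Analysis.FunctionSpaces.WightmanFamily d Unit, IsOSContinuationFamily S 𝒲 →
      Literature.Analysis.FunctionSpaces.IsLocalFamily 𝒲

/-- **(A₃, R2) Positivity of the OS boundary values** (Osterwalder–Schrader I (1973), §4.3,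
"Positivity": from reflection positivity E2, eqs. (4.18)–(4.28); the OS Hilbert space is the
Hilbert space of Wightman's reconstruction theorem). For an OS family `S` with E0' and its
continuation family `𝒲`, property (e) `IsPositiveDefiniteFamily`. Known theorem; proof
deferred. [cite: OsterwalderSchraderCMP1973, §4.3 (R2 from E2)] -/
def OS1973_positiveDefinite : Prop :=
  ∀ (d : ℕ) [NeZero d] (S : SchwingerFamily (EuclideanSpace ℝ (Fin (d + 1)))),
    S.IsOSFamily → S.HasLinearGrowth → ∀ 𝒲 : Literature.Analysis.FunctionSpaces.WightmanFamily d Unit, IsOSContinuationFamily S 𝒲 →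
      Literature.Analysis.FunctionSpaces.IsPositiveDefiniteFamily 𝒲

/-- **(A₃, R4) Cluster property of the OS boundary values** (Osterwalder–Schrader I (1973),
§4.4, "Cluster Property": E4 rewritten in vector notation by means of (4.22), eqs.
(4.29)–(4.30)). For an OS family `S`
with E0' and its continuation family `𝒲`, property (f) `HasClusterProperty` (Streater–Wightman
(3-31), spacelike `a`). Known theorem; proof deferred. [cite: OsterwalderSchraderCMP1973, §4.4 (R4 from E4)] -/
def OS1973_cluster : Prop :=
  ∀ (d : ℕ) [NeZero d] (S : SchwingerFamily (EuclideanSpace ℝ (Fin (d + 1)))),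
    S.IsOSFamily → S.HasLinearGrowth → ∀ 𝒲 : Literature.Analysis.FunctionSpaces.WightmanFamily d Unit, IsOSContinuationFamily S 𝒲 →
      Literature.Analysis.FunctionSpaces.HasClusterProperty 𝒲

/-- **Assembly of (A₃) from its conjuncts**: Lorentz invariance (R1, fact) plus the proved
translation invariance give (a); (b) spectral condition, (c) hermiticity, (d) locality,
(e) positivity, (f) cluster property are the facts above; `𝒲₀ = 1` is proved
(`IsOSContinuationFamily.isNormalisedFamily`). Real proof. [cite: OsterwalderSchraderCMP1973, §4.1–4.5] -/
theorem OS1973_isWightmanFamily_of_continuation_of_parts (hR1 : OS1973_lorentzInvariant)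
    (hR5 : OS1973_spectralCondition) (hH : OS1973_hermitian) (hR3 : OS1973_local)
    (hR2 : OS1973_positiveDefinite) (hR4 : OS1973_cluster) :
    OS1973_isWightmanFamily_of_continuation := by
  rw [isWightmanFamily_of_continuation_iff]
  intro d _ S hS hE0' 𝒲 h
  exact
    { poincare_invariant :=
        h.isPoincareInvariantFamily_of_lorentz hS.covariant (hR1 d S hS hE0' 𝒲 h)
      spectral := hR5 d S hS hE0' 𝒲 h
      hermitian := hH d S hS hE0' 𝒲 h
      local_comm := hR3 d S hS hE0' 𝒲 h
      positive := hR2 d S hS hE0' 𝒲 h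
      cluster := hR4 d S hS hE0' 𝒲 h
      normalised := h.isNormalisedFamily hS.normalized }

end Literature.MathematicalPhysics.QuantumFieldTheory

/-! ## Reality of reflection-positive Schwinger functions (E2) -/

namespace Literature.MathematicalPhysics.QuantumFieldTheory

open Complex ComplexConjugate

variable {E : Type*} [NormedAddCommGroup E] [NormedSpace ℝ E]

/-- Reindexing along a cast `Fin m ≃ Fin n` (`m = n`) does not change the value of a Schwinger
function: if `G' x = G (x ∘ Fin.cast h)` then `𝔖ₙ G' = 𝔖ₘ G`. [folklore] -/
theorem _root_.Literature.MathematicalPhysics.QuantumLattice.SchwingerFamily.apply_eq_of_comp_cast (S : SchwingerFamily E) {m n : ℕ} (h : m = n)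
    (G : 𝓢((Fin m → E), ℂ)) (G' : 𝓢((Fin n → E), ℂ))
    (hG : ∀ x : Fin n → E, G' x = G (x ∘ Fin.cast h)) : S n G' = S m G := by
  subst h
  have : G' = G := by
    ext x
    rw [hG x, Fin.cast_refl, Function.comp_id]
  rw [this]

/-- The OS adjoint of the zero test function is zero. [folklore] -/
@[simp]
theorem osAdjoint_zero {d : ℕ} [NeZero d] {n : ℕ} :
    osAdjoint (0 : 𝓢((Fin n → EuclideanSpace ℝ (Fin d)), ℂ)) = 0 := by
  ext x; simp

/-- An append-tensor product with a zero left factor is zero. [folklore] -/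
theorem _root_.Literature.MathematicalPhysics.QuantumLattice.IsAppendTensorOf.eq_zero_of_left {n m : ℕ} {H : 𝓢((Fin (n + m) → E), ℂ)}
    {G : 𝓢((Fin m → E), ℂ)} (hH : IsAppendTensorOf H 0 G) : H = 0 := by
  ext x; simp [hH x]

/-- An append-tensor product with a zero right factor is zero. [folklore] -/
theorem _root_.Literature.MathematicalPhysics.QuantumLattice.IsAppendTensorOf.eq_zero_of_right {n m : ℕ} {H : 𝓢((Fin (n + m) → E), ℂ)}
    {F : 𝓢((Fin n → E), ℂ)} (hH : IsAppendTensorOf H F 0) : H = 0 := by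
  ext x; simp [hH x]

/-- The zero test function is positive-time (empty support). [folklore] -/
theorem isPositiveTimeMulti_zero {d : ℕ} [NeZero d] {n : ℕ} :
    IsPositiveTimeMulti (0 : 𝓢((Fin n → EuclideanSpace ℝ (Fin d)), ℂ)) := by
  intro x hx
  simp [tsupport, FunLike.coe_zero] at hx

/-- Every zero-point test function is positive-time (no arguments to constrain). [folklore] -/
theorem isPositiveTimeMulti_of_zero {d : ℕ} [NeZero d]
    (F : 𝓢((Fin 0 → EuclideanSpace ℝ (Fin d)), ℂ)) : IsPositiveTimeMulti F :=
  fun _ _ i => i.elim0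

section SchwingerFamily
open Literature.MathematicalPhysics.QuantumLattice (SchwingerFamily)
open Literature.MathematicalPhysics.QuantumLattice.SchwingerFamily

variable {d : ℕ} [NeZero d]

/-- **Reality of reflection-positive Schwinger functions** (Osterwalder–Schrader I (1973), §4.3
and (4.2); Glimm–Jaffe (1987) §6.1): for an OS family and a positive-time test function `F`,
`𝔖ₙ(ΘF*) = conj 𝔖ₙ(F)`. Proof: reflection positivity E2 for the two-term sequence
`(c · 1₀, F)` gives `Im (|c|² + c̄ 𝔖ₙ(F) + c 𝔖ₙ(ΘF*) + 𝔖₂ₙ(ΘF* ⊗ F)) = 0` for every `c ∈ ℂ`;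
comparing `c = 1, i, -i` yields the claim. [cite: OsterwalderSchraderCMP1973, §4.3] -/
theorem _root_.Literature.MathematicalPhysics.QuantumLattice.SchwingerFamily.IsOSFamily.apply_osAdjoint {S : SchwingerFamily (EuclideanSpace ℝ (Fin d))}
    (hS : S.IsOSFamily) {n : ℕ} {F : 𝓢((Fin n → EuclideanSpace ℝ (Fin d)), ℂ)}
    (hF : IsPositiveTimeMulti F) : S n (osAdjoint F) = conj (S n F) := by
  rcases eq_or_ne n 0 with rfl | hn
  · rw [hS.normalized, hS.normalized, osAdjoint_apply]
    exact congrArg _ (congrArg F (Subsingleton.elim _ _))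
  -- the two-term sequence `(c, 0, …, 0, F, 0, …)`
  set A := S n F with hA
  set B := S n (osAdjoint F) with hB
  have key : ∀ c : ℂ, ∃ w : ℂ, (conj c * c + conj c * A + c * B + w).im = 0 ∧
      w = S (n + n) (SchwartzMap.appendTensor (osAdjoint F) F) := by
    intro c
    set c₀ : 𝓢((Fin 0 → EuclideanSpace ℝ (Fin d)), ℂ) := SchwartzMap.constOfSubsingleton c
    set sq : (m : ℕ) → 𝓢((Fin m → EuclideanSpace ℝ (Fin d)), ℂ) :=
      Function.update (Function.update 0 0 c₀) n F with hsq
    have hsq_n : sq n = F := by simp [hsq]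
    have hsq_0 : sq 0 = c₀ := by
      rw [hsq, Function.update_of_ne hn.symm, Function.update_self]
    have hsq_ne : ∀ m, m ≠ 0 → m ≠ n → sq m = 0 := fun m h0 hmn => by
      rw [hsq, Function.update_of_ne hmn, Function.update_of_ne h0]; rfl
    set H : (a b : ℕ) → 𝓢((Fin (a + b) → EuclideanSpace ℝ (Fin d)), ℂ) :=
      fun a b => SchwartzMap.appendTensor (osAdjoint (sq a)) (sq b) with hH
    have hE2 := hS.reflectionPositive n sq
      (fun m hm => hsq_ne m (by omega) (by omega))
      (fun m => by
        rcases eq_or_ne m n with rfl | hmn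
        · rw [hsq_n]; exact hF
        rcases eq_or_ne m 0 with rfl | hm0
        · rw [hsq_0]; exact isPositiveTimeMulti_of_zero _
        · rw [hsq_ne m hm0 hmn]; exact isPositiveTimeMulti_zero)
      H (fun a b => isAppendTensorOf_appendTensor _ _)
    obtain ⟨-, him⟩ := hE2
    refine ⟨S (n + n) (H n n), ?_, by simp only [hH, hsq_n]⟩
    -- collapse the double sum to the four surviving terms
    have hvan_a : ∀ a, a ≠ 0 → a ≠ n → ∀ b, S (a + b) (H a b) = 0 := fun a h0 han b => by
      have : H a b = 0 := IsAppendTensorOf.eq_zero_of_left (by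
        rw [← osAdjoint_zero, ← hsq_ne a h0 han]; exact isAppendTensorOf_appendTensor _ _)
      rw [this, map_zero]
    have hvan_b : ∀ b, b ≠ 0 → b ≠ n → ∀ a, S (a + b) (H a b) = 0 := fun b h0 hbn a => by
      have : H a b = 0 := IsAppendTensorOf.eq_zero_of_right (by
        rw [← hsq_ne b h0 hbn]; exact isAppendTensorOf_appendTensor _ _)
      rw [this, map_zero]
    have h0mem : 0 ∈ Finset.range (n + 1) := by simp
    have hnmem : n ∈ Finset.range (n + 1) := by simp
    have hsum : ∑ a ∈ Finset.range (n + 1), ∑ b ∈ Finset.range (n + 1), S (a + b) (H a b) =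
        (S (0 + 0) (H 0 0) + S (0 + n) (H 0 n)) + (S (n + 0) (H n 0) + S (n + n) (H n n)) := by
      rw [Finset.sum_eq_add_of_mem 0 n h0mem hnmem hn.symm (fun a _ ha =>
        Finset.sum_eq_zero fun b _ => hvan_a a ha.1 ha.2 b)]
      rw [Finset.sum_eq_add_of_mem 0 n h0mem hnmem hn.symm (fun b _ hb => hvan_b b hb.1 hb.2 0),
        Finset.sum_eq_add_of_mem 0 n h0mem hnmem hn.symm (fun b _ hb => hvan_b b hb.1 hb.2 n)]
    -- identify the four terms
    have h00 : S (0 + 0) (H 0 0) = conj c * c := by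
      have h := hS.normalized (H 0 0)
      rw [h, hH]
      show osAdjoint (sq 0) _ * sq 0 _ = _
      rw [hsq_0]
      simp [c₀]
    have h0n : S (0 + n) (H 0 n) = conj c * A := by
      rw [hA, ← smul_eq_mul, ← map_smul]
      refine (S.apply_eq_of_comp_cast (Nat.zero_add n) (H 0 n) ((starRingEnd ℂ) c • F) ?_).symm
      intro x
      rw [hH]
      simp only [SchwartzMap.appendTensor_apply, hsq_0, hsq_n, osAdjoint_apply, c₀,
        SchwartzMap.constOfSubsingleton_apply, smul_apply, smul_eq_mul]
      congr 2
      funext i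
      simp only [Function.comp_apply]
      congr 1
      ext; simp
    have hn0 : S (n + 0) (H n 0) = c * B := by
      show S n (H n 0) = _
      rw [hB, ← smul_eq_mul, ← map_smul]
      congr 1
      ext x
      rw [hH]
      simp only [SchwartzMap.appendTensor_apply, hsq_0, hsq_n, c₀,
        SchwartzMap.constOfSubsingleton_apply, smul_apply, smul_eq_mul, mul_comm _ c,
        Fin.castAdd_zero, Fin.cast_refl, Function.comp_id]
    rw [hsum, h00, h0n, hn0] at him
    convert him using 2
    ring
  -- compare `c = 1`, `c = I`, `c = -I`
  obtain ⟨w, h1, hw1⟩ := key 1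
  obtain ⟨w', hI, hw2⟩ := key I
  obtain ⟨w'', hnI, hw3⟩ := key (-I)
  have hw' : w' = w := hw2.trans hw1.symm
  have hw'' : w'' = w := hw3.trans hw1.symm
  subst hw' hw''
  simp only [map_one, one_mul, Complex.conj_I, map_neg, neg_mul, neg_neg, Complex.add_im,
    Complex.mul_im, Complex.I_re, Complex.I_im, Complex.neg_re, Complex.neg_im, Complex.one_im] at h1 hI hnI
  apply Complex.ext
  · simp only [Complex.conj_re]; linarith
  · simp only [Complex.conj_im]; linarith

end SchwingerFamily

end Literature.MathematicalPhysics.QuantumFieldTheory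

/-! ## The time-shift extension of an OS continuation and the reflected continuation -/

namespace Literature.MathematicalPhysics.QuantumFieldTheory

open Complex ComplexConjugate

variable {d n : ℕ}

/-! ### The relative forward tube and imaginary time shifts -/

variable (d n) in
/-- The **relative forward tube**: complex configurations whose successive differences have
imaginary parts in `V₊`, `Im (z_k − z_{k-1}) ∈ V₊` for `1 ≤ k < n`, with *no* condition on
`Im z₀` (Streater–Wightman (1964), §2-4/§3-3: the tube in the difference variables only; H21's
`forwardTube` adds `Im z₀ ∈ V₊`). [cite: StreaterWightman1964, §3-3] -/
def relForwardTube : Set (Fin n → Fin (d + 1) → ℂ) :=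
  {z | ∀ k : Fin n, 0 < (k : ℕ) → imPart (succDiff z k) ∈ forwardCone d}

/-- The forward tube lies in the relative forward tube. [folklore] -/
theorem forwardTube_subset_relForwardTube : forwardTube d n ⊆ relForwardTube d n :=
  fun _ hz k _ => hz k

variable (d n) in
/-- The imaginary diagonal time shift `i s ê₀ · (1, …, 1)`, written as the Euclidean point of the
constant configuration `(s ê₀, …, s ê₀)` (cf. `euclideanPoint_const_single`). [folklore] -/
def iTimeShift (s : ℝ) : Fin n → Fin (d + 1) → ℂ :=
  euclideanPoint fun _ : Fin n => (EuclideanSpace.single 0 s : EuclideanSpace ℝ (Fin (d + 1)))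

/-- `iTimeShift` is additive in the shift. [folklore] -/
theorem iTimeShift_add (s s' : ℝ) : iTimeShift d n (s + s') = iTimeShift d n s + iTimeShift d n s' := by
  rw [iTimeShift, iTimeShift, iTimeShift, ← euclideanPoint_add]
  congr 1
  funext k
  ext μ
  by_cases hμ : μ = 0 <;> simp [hμ]

/-- `iTimeShift 0 = 0`. [folklore] -/
@[simp]
theorem iTimeShift_zero : iTimeShift d n 0 = 0 := by
  funext k μ
  by_cases hμ : μ = 0
  · subst hμ; simp [iTimeShift]
  · simp [iTimeShift, euclideanPoint, hμ]

/-- Imaginary parts of successive differences after an imaginary time shift: only the `k = 0`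
difference moves, by `s ê₀`. [folklore] -/
theorem imPart_succDiff_add_iTimeShift (z : Fin n → Fin (d + 1) → ℂ) (s : ℝ) (k : Fin n) :
    imPart (succDiff (z + iTimeShift d n s) k) =
      imPart (succDiff z k) + if (k : ℕ) = 0 then s • e₀ d else 0 := by
  rw [succDiff_add, imPart_add]
  congr 1
  cases n with
  | zero => exact k.elim0
  | succ m =>
    refine Fin.cases ?_ (fun j => ?_) k
    · simp [iTimeShift]
    · rw [succDiff_succ, imPart_sub]
      simp [iTimeShift]

/-- Membership in the forward tube after an imaginary time shift: the shifted configuration is in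
`𝒯ₙ` iff `Im z₀ + s ê₀ ∈ V₊` and `z` is in the relative tube. [folklore] -/
theorem add_iTimeShift_mem_forwardTube_iff (z : Fin n → Fin (d + 1) → ℂ) (s : ℝ) :
    z + iTimeShift d n s ∈ forwardTube d n ↔
      (∀ k : Fin n, (k : ℕ) = 0 → imPart (z k) + s • e₀ d ∈ forwardCone d) ∧
        z ∈ relForwardTube d n := by
  simp only [mem_forwardTube_iff, imPart_succDiff_add_iTimeShift]
  constructor
  · intro h
    refine ⟨fun k hk => ?_, fun k hk => ?_⟩
    · have := h k
      rw [if_pos hk] at this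
      cases n with
      | zero => exact k.elim0
      | succ m =>
        have hk0 : k = 0 := Fin.ext hk
        subst hk0
        simpa using this
    · have := h k
      rwa [if_neg hk.ne', add_zero] at this
  · rintro ⟨h0, hrel⟩ k
    by_cases hk : (k : ℕ) = 0
    · rw [if_pos hk]
      cases n with
      | zero => exact k.elim0
      | succ m =>
        have hk0 : k = 0 := Fin.ext hk
        subst hk0
        simpa using h0 0 rfl
    · rw [if_neg hk, add_zero]
      exact hrel k (Nat.pos_of_ne_zero hk)

/-- A canonical admissible shift: `σ z = 1 + 2 ∑_k ‖Im z_k‖`. [folklore] -/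
def admissibleShift (z : Fin n → Fin (d + 1) → ℂ) : ℝ := 1 + 2 * ∑ k, ‖imPart (z k)‖

/-- `p + s ê₀ ∈ V₊` whenever `s ≥ 1 + 2‖p‖` (then `p⁰ + s ≥ 1 + ‖p‖ > ‖p⃗‖`). [folklore] -/
theorem add_smul_e₀_mem_forwardCone_of_le {p : SpaceTime d} {s : ℝ} (hs : 1 + 2 * ‖p‖ ≤ s) :
    p + s • e₀ d ∈ forwardCone d := by
  rw [mem_forwardCone_iff_norm_lt]
  have h1 : spaceC d (p + s • e₀ d) = spaceC d p := by
    ext i; simp [e₀, Fin.succ_ne_zero]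
  have h2 : (p + s • e₀ d) 0 = p 0 + s := by simp [e₀]
  rw [h1, h2]
  have hsp : ‖spaceC d p‖ ≤ ‖p‖ := by
    rw [EuclideanSpace.norm_eq, EuclideanSpace.norm_eq]
    refine Real.sqrt_le_sqrt ?_
    rw [Fin.sum_univ_succ]
    simp only [spaceC_apply]
    nlinarith [sq_nonneg (p 0)]
  have hp0 : |p 0| ≤ ‖p‖ := by
    have := PiLp.norm_apply_le (p := 2) p 0
    rwa [Real.norm_eq_abs] at this
  have := neg_abs_le (p 0)
  linarith

/-- The canonical shift is admissible on the relative tube: `z + i σ(z) ê₀ ∈ 𝒯ₙ`. [folklore] -/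
theorem add_iTimeShift_admissibleShift_mem {z : Fin n → Fin (d + 1) → ℂ}
    (hz : z ∈ relForwardTube d n) :
    z + iTimeShift d n (admissibleShift z) ∈ forwardTube d n := by
  rw [add_iTimeShift_mem_forwardTube_iff]
  refine ⟨fun k _ => add_smul_e₀_mem_forwardCone_of_le ?_, hz⟩
  unfold admissibleShift
  have : ‖imPart (z k)‖ ≤ ∑ j, ‖imPart (z j)‖ :=
    Finset.single_le_sum (f := fun j => ‖imPart (z j)‖) (fun j _ => norm_nonneg _)
      (Finset.mem_univ k)
  linarith

/-! ### The time-shift extension -/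

/-- The **time-shift extension** of a function on the forward tube to the relative tube:
`𝔚ext z = 𝔚 (z + i σ(z) ê₀)` with the canonical admissible shift `σ`. For `𝔚` invariant under
imaginary time shifts (as the continued Schwinger functions are, by E1) the value does not
depend on the admissible shift (`tubeExtension_eq`), `𝔚ext = 𝔚` on `𝒯ₙ` and `𝔚ext` is
holomorphic on the relative tube. [folklore] -/
def tubeExtension (𝔚 : (Fin n → Fin (d + 1) → ℂ) → ℂ) (z : Fin n → Fin (d + 1) → ℂ) : ℂ :=
  𝔚 (z + iTimeShift d n (admissibleShift z))

section Extension

variable {𝔚 : (Fin n → Fin (d + 1) → ℂ) → ℂ}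

/-- Invariance under nonnegative imaginary time shifts on the tube implies that the value
`𝔚 (z + i s ê₀)` is the same for all admissible `s`. [folklore] -/
theorem apply_add_iTimeShift_eq_of_mem
    (hinv : ∀ s : ℝ, 0 ≤ s → ∀ z ∈ forwardTube d n, 𝔚 (z + iTimeShift d n s) = 𝔚 z)
    {z : Fin n → Fin (d + 1) → ℂ} {s s' : ℝ} (hs : z + iTimeShift d n s ∈ forwardTube d n)
    (hs' : z + iTimeShift d n s' ∈ forwardTube d n) :
    𝔚 (z + iTimeShift d n s) = 𝔚 (z + iTimeShift d n s') := by
  wlog h : s ≤ s' generalizing s s'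
  · exact (this hs' hs (le_of_not_ge h)).symm
  have : z + iTimeShift d n s' = (z + iTimeShift d n s) + iTimeShift d n (s' - s) := by
    rw [add_assoc, ← iTimeShift_add, add_sub_cancel]
  rw [this, hinv (s' - s) (sub_nonneg.2 h) _ hs]

/-- The extension evaluated with any admissible shift. [folklore] -/
theorem tubeExtension_eq
    (hinv : ∀ s : ℝ, 0 ≤ s → ∀ z ∈ forwardTube d n, 𝔚 (z + iTimeShift d n s) = 𝔚 z)
    {z : Fin n → Fin (d + 1) → ℂ} (hz : z ∈ relForwardTube d n) {s : ℝ}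
    (hs : z + iTimeShift d n s ∈ forwardTube d n) :
    tubeExtension 𝔚 z = 𝔚 (z + iTimeShift d n s) :=
  apply_add_iTimeShift_eq_of_mem hinv (add_iTimeShift_admissibleShift_mem hz) hs

/-- The extension agrees with `𝔚` on the forward tube. [folklore] -/
theorem tubeExtension_eq_self
    (hinv : ∀ s : ℝ, 0 ≤ s → ∀ z ∈ forwardTube d n, 𝔚 (z + iTimeShift d n s) = 𝔚 z)
    {z : Fin n → Fin (d + 1) → ℂ} (hz : z ∈ forwardTube d n) : tubeExtension 𝔚 z = 𝔚 z := by
  rw [tubeExtension_eq hinv (forwardTube_subset_relForwardTube hz) (s := 0) (by simpa using hz)]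
  simp

/-- The extension is invariant under all real imaginary-time shifts within the relative tube. [folklore] -/
theorem tubeExtension_add_iTimeShift
    (hinv : ∀ s : ℝ, 0 ≤ s → ∀ z ∈ forwardTube d n, 𝔚 (z + iTimeShift d n s) = 𝔚 z)
    {z : Fin n → Fin (d + 1) → ℂ} (hz : z ∈ relForwardTube d n) (s : ℝ) :
    tubeExtension 𝔚 (z + iTimeShift d n s) = tubeExtension 𝔚 z := by
  have hz' : z + iTimeShift d n s ∈ relForwardTube d n := by
    intro k hk
    rw [imPart_succDiff_add_iTimeShift, if_neg hk.ne', add_zero]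
    exact hz k hk
  rw [tubeExtension, add_assoc, ← iTimeShift_add]
  exact (tubeExtension_eq hinv hz (by
    rw [iTimeShift_add, ← add_assoc]; exact add_iTimeShift_admissibleShift_mem hz')).symm

/-- `z ↦ z + i s ê₀` is continuous (affine). [folklore] -/
theorem continuous_add_iTimeShift (s : ℝ) :
    Continuous fun z : Fin n → Fin (d + 1) → ℂ => z + iTimeShift d n s :=
  continuous_id.add continuous_const

/-- The extension is holomorphic at every point of the relative tube: near `z₀` it is
`z ↦ 𝔚 (z + i s₀ ê₀)` with the *fixed* shift `s₀ = σ(z₀)`. [folklore] -/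
theorem differentiableAt_tubeExtension (h𝔚 : DifferentiableOn ℂ 𝔚 (forwardTube d n))
    (hinv : ∀ s : ℝ, 0 ≤ s → ∀ z ∈ forwardTube d n, 𝔚 (z + iTimeShift d n s) = 𝔚 z)
    {z₀ : Fin n → Fin (d + 1) → ℂ} (hz₀ : z₀ ∈ relForwardTube d n) :
    DifferentiableAt ℂ (tubeExtension 𝔚) z₀ := by
  set s₀ := admissibleShift z₀
  set U : Set (Fin n → Fin (d + 1) → ℂ) := (fun z => z + iTimeShift d n s₀) ⁻¹' forwardTube d n
  have hUo : IsOpen U := isOpen_forwardTube.preimage (continuous_add_iTimeShift s₀)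
  have hz₀U : z₀ ∈ U := add_iTimeShift_admissibleShift_mem hz₀
  have hUrel : U ⊆ relForwardTube d n := fun z hz =>
    ((add_iTimeShift_mem_forwardTube_iff z s₀).1 hz).2
  have hdiff : DifferentiableOn ℂ (fun z => 𝔚 (z + iTimeShift d n s₀)) U :=
    h𝔚.comp (differentiableOn_id.add (differentiableOn_const _)) (Set.mapsTo_preimage _ _)
  have heq : Set.EqOn (tubeExtension 𝔚) (fun z => 𝔚 (z + iTimeShift d n s₀)) U :=
    fun z hz => tubeExtension_eq hinv (hUrel hz) hz
  exact ((hdiff.differentiableAt (hUo.mem_nhds hz₀U)).congr_of_eventuallyEq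
    (Filter.eventuallyEq_of_mem (hUo.mem_nhds hz₀U) heq))

end Extension


/-! ### Conjugate-reversed configurations -/

/-- The **conjugate reversal** of a complex configuration: `(revConj w)_k = conj (w_{n-1-k})`
(componentwise complex conjugation, arguments in reverse order). This is the anti-holomorphic
involution under which hermiticity `𝒲ₙ(x₁,…,xₙ)^* = 𝒲ₙ(xₙ,…,x₁)` of the Wightman functions is
expressed on the forward tube (Streater–Wightman (1964), §3-3, eq. (3-25) and Thm. 3-5). [cite: StreaterWightman1964, §3-3 (3-25)] -/
def revConj (w : Fin n → Fin (d + 1) → ℂ) : Fin n → Fin (d + 1) → ℂ :=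
  fun k μ => conj (w (Fin.rev k) μ)

/-- Components of `revConj`. [folklore] -/
@[simp]
theorem revConj_apply (w : Fin n → Fin (d + 1) → ℂ) (k : Fin n) (μ : Fin (d + 1)) :
    revConj w k μ = conj (w (Fin.rev k) μ) := rfl

/-- `revConj` is an involution. [folklore] -/
@[simp]
theorem revConj_revConj (w : Fin n → Fin (d + 1) → ℂ) : revConj (revConj w) = w := by
  funext k μ; simp [Fin.rev_rev]

/-- Imaginary parts under `revConj`: `Im (revConj w)_k = − Im w_{rev k}`. [folklore] -/
theorem imPart_revConj (w : Fin n → Fin (d + 1) → ℂ) (k : Fin n) :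
    imPart (revConj w k) = -imPart (w (Fin.rev k)) := by
  ext μ; simp [imPart_apply]

/-- `revConj` maps the forward tube into the relative forward tube: the successive differences
are reversed and conjugated, `Im ((revConj w)_{j+1} − (revConj w)_j) = Im (succDiff w (rev j + 1))`. [folklore] -/
theorem revConj_mem_relForwardTube {w : Fin n → Fin (d + 1) → ℂ} (hw : w ∈ forwardTube d n) :
    revConj w ∈ relForwardTube d n := by
  intro k hk
  cases n with
  | zero => exact k.elim0
  | succ m =>
    obtain ⟨j, rfl⟩ : ∃ j : Fin m, k = j.succ := by
      refine ⟨k.pred (fun h => by simp [h] at hk), by simp⟩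
    rw [succDiff_succ, imPart_sub, imPart_revConj, imPart_revConj, Fin.rev_succ, Fin.rev_castSucc]
    have := hw (Fin.rev j).succ
    rw [succDiff_succ, imPart_sub] at this
    convert this using 1
    abel

/-- `revConj` as a continuous `ℝ`-linear automorphism (reindexing composed with componentwise
conjugation). [folklore] -/
def revConjCLE : (Fin n → Fin (d + 1) → ℂ) ≃L[ℝ] (Fin n → Fin (d + 1) → ℂ) :=
  (ContinuousLinearEquiv.piCongrLeft ℝ (fun _ : Fin n => Fin (d + 1) → ℂ) Fin.revPerm).trans
    (ContinuousLinearEquiv.piCongrRight fun _ : Fin n =>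
      ContinuousLinearEquiv.piCongrRight fun _ : Fin (d + 1) => (Complex.conjCLE : ℂ ≃L[ℝ] ℂ))

/-- `revConjCLE` is `revConj`. [folklore] -/
@[simp]
theorem revConjCLE_apply (w : Fin n → Fin (d + 1) → ℂ) : revConjCLE w = revConj w := by
  funext k μ
  simp only [revConjCLE, ContinuousLinearEquiv.trans_apply, ContinuousLinearEquiv.piCongrRight_apply,
    Complex.conjCLE_apply, revConj_apply]
  congr 2
  simp [ContinuousLinearEquiv.piCongrLeft, Equiv.piCongrLeft_apply_eq_cast]

/-- `revConj` is continuous. [folklore] -/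
theorem continuous_revConj : Continuous (revConj : (Fin n → Fin (d + 1) → ℂ) → _) := by
  have : (revConj : (Fin n → Fin (d + 1) → ℂ) → _) = revConjCLE := by
    funext w; exact (revConjCLE_apply w).symm
  rw [this]
  exact revConjCLE.continuous

/-- `revConj` is conjugate-linear: `revConj (c • w) = conj c • revConj w`. [folklore] -/
theorem revConj_smul (c : ℂ) (w : Fin n → Fin (d + 1) → ℂ) :
    revConj (c • w) = conj c • revConj w := by
  funext k μ; simp

/-- **Conjugate–reverse–conjugate preserves holomorphy.** If `f` is complex differentiable at
`revConj w`, then `w ↦ conj (f (revConj w))` is complex differentiable at `w` (its real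
derivative `v ↦ conj (f' (revConj v))` is complex linear, being conjugate-linear twice). [folklore] -/
theorem DifferentiableAt.conj_comp_revConj {f : (Fin n → Fin (d + 1) → ℂ) → ℂ}
    {w : Fin n → Fin (d + 1) → ℂ} (hf : DifferentiableAt ℂ f (revConj w)) :
    DifferentiableAt ℂ (fun v => conj (f (revConj v))) w := by
  -- real differentiability by the chain rule
  have hfR : DifferentiableAt ℝ f (revConj w) := hf.restrictScalars ℝ
  have hrc : DifferentiableAt ℝ (revConj : (Fin n → Fin (d + 1) → ℂ) → _) w := by
    have : (revConj : (Fin n → Fin (d + 1) → ℂ) → _) = revConjCLE := by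
      funext v; exact (revConjCLE_apply v).symm
    rw [this]; exact (revConjCLE (d := d) (n := n)).differentiableAt
  have hcomp : DifferentiableAt ℝ (fun v => f (revConj v)) w := hfR.comp w hrc
  have hg : DifferentiableAt ℝ (fun v => conj (f (revConj v))) w :=
    (Complex.conjCLE : ℂ →L[ℝ] ℂ).differentiableAt.comp w hcomp
  -- the real derivative
  set f' : (Fin n → Fin (d + 1) → ℂ) →L[ℂ] ℂ := fderiv ℂ f (revConj w)
  have hderiv : fderiv ℝ (fun v => conj (f (revConj v))) w =
      (Complex.conjCLE : ℂ →L[ℝ] ℂ).comp ((f'.restrictScalars ℝ).comp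
        ((revConjCLE (d := d) (n := n)).toContinuousLinearMap)) := by
    have h1 : HasFDerivAt (revConj : (Fin n → Fin (d + 1) → ℂ) → _)
        ((revConjCLE (d := d) (n := n)).toContinuousLinearMap) w := by
      have : (revConj : (Fin n → Fin (d + 1) → ℂ) → _) = revConjCLE := by
        funext v; exact (revConjCLE_apply v).symm
      rw [this]; exact (revConjCLE (d := d) (n := n)).hasFDerivAt
    have h2 : HasFDerivAt f (f'.restrictScalars ℝ) (revConj w) :=
      (hf.hasFDerivAt).restrictScalars ℝ
    have h3 := h2.comp w h1
    have h4 := (Complex.conjCLE : ℂ →L[ℝ] ℂ).hasFDerivAt.comp w h3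
    exact h4.fderiv
  -- which is complex linear
  set L : (Fin n → Fin (d + 1) → ℂ) →L[ℂ] ℂ :=
    { toFun := fun v => conj (f' (revConj v))
      map_add' := fun v v' => by
        have : revConj (v + v') = revConj v + revConj v' := by funext k μ; simp
        rw [this, map_add, map_add]
      map_smul' := fun c v => by
        rw [revConj_smul, map_smul, smul_eq_mul, map_mul, Complex.conj_conj, RingHom.id_apply,
          smul_eq_mul]
      cont := Complex.continuous_conj.comp (f'.continuous.comp continuous_revConj) }
  refine (differentiableAt_iff_restrictScalars ℝ hg).2 ⟨L, ?_⟩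
  rw [hderiv]
  ext v
  simp [L]


/-! ### Reindexing and reflecting Lebesgue integrals over configurations -/

/-- Reversing the order of the arguments preserves Lebesgue measure on configurations:
`∫ G(x_{n-1}, …, x_0) dx = ∫ G(y) dy`. [folklore] -/
theorem integral_comp_rev {E : Type*} [MeasureSpace E] [SigmaFinite (volume : Measure E)]
    {G' : Type*} [NormedAddCommGroup G'] [NormedSpace ℝ G'] (G : (Fin n → E) → G') :
    ∫ x : Fin n → E, G (fun k => x (Fin.rev k)) = ∫ y : Fin n → E, G y := by
  have h := ((volume_measurePreserving_piCongrLeft (fun _ : Fin n => E) Fin.revPerm).symm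
    (MeasurableEquiv.piCongrLeft (fun _ : Fin n => E) Fin.revPerm)).integral_comp' G
  exact h

/-- Time-reflecting every argument preserves Lebesgue measure on Euclidean configurations. [folklore] -/
theorem integral_comp_timeReflection {G' : Type*} [NormedAddCommGroup G'] [NormedSpace ℝ G']
    (G : (Fin n → EuclideanSpace ℝ (Fin (d + 1))) → G') :
    ∫ x : Fin n → EuclideanSpace ℝ (Fin (d + 1)), G (fun k => timeReflection (d + 1) (x k)) =
      ∫ y, G y := by
  have hθ : MeasurePreserving (timeReflection (d + 1) :
      EuclideanSpace ℝ (Fin (d + 1)) → EuclideanSpace ℝ (Fin (d + 1))) :=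
    (timeReflection (d + 1)).measurePreserving
  have hpi := volume_preserving_pi (fun _ : Fin n => hθ)
  set e : (Fin n → EuclideanSpace ℝ (Fin (d + 1))) ≃ᵐ (Fin n → EuclideanSpace ℝ (Fin (d + 1))) :=
    MeasurableEquiv.piCongrRight fun _ =>
      (timeReflection (d + 1)).toHomeomorph.toMeasurableEquiv
  have he : MeasurePreserving e := hpi
  exact he.integral_comp' G

/-! ### Reversed directions and rays -/

/-- The ray `x + i t η` in complexified configuration space. [folklore] -/
theorem revConj_ray (x η : Fin n → SpaceTime d) (t : ℝ) :
    revConj (fun k => complexifyPoint (x k) + ((t : ℂ) * I) • complexifyPoint (η k)) =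
      fun k => complexifyPoint (x (Fin.rev k)) + ((t : ℂ) * I) • complexifyPoint (-η (Fin.rev k)) := by
  funext k μ
  simp only [revConj_apply, Pi.add_apply, Pi.smul_apply, complexifyPoint_apply, smul_eq_mul,
    map_add, map_mul, Complex.conj_ofReal, Complex.conj_I, PiLp.neg_apply, Complex.ofReal_neg]
  ring

/-- The **reversed direction** `η'_k = S ê₀ − η_{n-1-k}`: the base-cone direction along which
the reflected continuation takes its boundary values. [folklore] -/
def revDir (S : ℝ) (η : Fin n → SpaceTime d) : Fin n → SpaceTime d :=
  fun k => S • e₀ d - η (Fin.rev k)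

/-- For `η` in the base cone and `S = 1 + 2 ∑_k ‖η_k‖`, the reversed direction is again in the
base cone (its successive differences are those of `η` in reverse order; its first entry
`S ê₀ − η_{n-1}` lies in `V₊` for `S` large). [folklore] -/
theorem revDir_mem_tubeCone {η : Fin n → SpaceTime d} (hη : η ∈ tubeCone d n) :
    revDir (1 + 2 * ∑ k, ‖η k‖) η ∈ tubeCone d n := by
  intro k
  cases n with
  | zero => exact k.elim0
  | succ m =>
    refine Fin.cases ?_ (fun j => ?_) k
    · rw [succDiff_zero, revDir, sub_eq_neg_add]
      refine add_smul_e₀_mem_forwardCone_of_le ?_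
      rw [norm_neg]
      have : ‖η (Fin.rev 0)‖ ≤ ∑ k, ‖η k‖ :=
        Finset.single_le_sum (f := fun k => ‖η k‖) (fun k _ => norm_nonneg _) (Finset.mem_univ _)
      linarith
    · rw [succDiff_succ, revDir, revDir, Fin.rev_succ, Fin.rev_castSucc]
      have := hη (Fin.rev j).succ
      rw [succDiff_succ] at this
      convert this using 1
      abel

/-- The reflected ray, shifted by `i t S ê₀`, is the ray from the reversed base point in the
reversed direction. [folklore] -/
theorem revConj_ray_add_iTimeShift (x η : Fin n → SpaceTime d) (t S : ℝ) :
    revConj (fun k => complexifyPoint (x k) + ((t : ℂ) * I) • complexifyPoint (η k)) +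
        iTimeShift d n (t * S) =
      fun k => complexifyPoint (x (Fin.rev k)) + ((t : ℂ) * I) • complexifyPoint (revDir S η k) := by
  rw [revConj_ray]
  funext k μ
  by_cases hμ : μ = 0
  · subst hμ
    simp [iTimeShift, revDir, e₀]
    ring
  · simp [iTimeShift, euclideanPoint, hμ, revDir, e₀]

/-! ### The reflected continuation -/

/-- The **reflected continuation** `𝔚†(w) = conj 𝔚ext(revConj w)` of a function on the forward
tube (via its time-shift extension to the relative tube): the holomorphic function whose
boundary value is `F ↦ conj T(F*)` when `T` is the boundary value of `𝔚`
(Streater–Wightman (1964), §3-3, hermiticity (3-25) on the level of the holomorphic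
continuation). [cite: StreaterWightman1964, §3-3 (3-25)] -/
def reflectFn (𝔚 : (Fin n → Fin (d + 1) → ℂ) → ℂ) (w : Fin n → Fin (d + 1) → ℂ) : ℂ :=
  conj (tubeExtension 𝔚 (revConj w))

section Reflect

variable {𝔚 : (Fin n → Fin (d + 1) → ℂ) → ℂ}

/-- The reflected continuation is holomorphic on the forward tube. [folklore] -/
theorem differentiableOn_reflectFn (h𝔚 : DifferentiableOn ℂ 𝔚 (forwardTube d n))
    (hinv : ∀ s : ℝ, 0 ≤ s → ∀ z ∈ forwardTube d n, 𝔚 (z + iTimeShift d n s) = 𝔚 z) :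
    DifferentiableOn ℂ (reflectFn 𝔚) (forwardTube d n) := fun _ hw =>
  (DifferentiableAt.conj_comp_revConj
    (differentiableAt_tubeExtension h𝔚 hinv (revConj_mem_relForwardTube hw))).differentiableWithinAt

/-- The reflected continuation on a ray `x + i t η`, `t > 0`, `η` in the base cone:
`𝔚†(x + i t η) = conj 𝔚 (rev x + i t η')` with the reversed direction `η'`. [folklore] -/
theorem reflectFn_ray (hinv : ∀ s : ℝ, 0 ≤ s → ∀ z ∈ forwardTube d n, 𝔚 (z + iTimeShift d n s) = 𝔚 z)
    {η : Fin n → SpaceTime d} (hη : η ∈ tubeCone d n) (x : Fin n → SpaceTime d) {t : ℝ}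
    (ht : 0 < t) :
    reflectFn 𝔚 (fun k => complexifyPoint (x k) + ((t : ℂ) * I) • complexifyPoint (η k)) =
      conj (𝔚 fun k => complexifyPoint (x (Fin.rev k)) +
        ((t : ℂ) * I) • complexifyPoint (revDir (1 + 2 * ∑ k, ‖η k‖) η k)) := by
  rw [reflectFn]
  congr 1
  have hmem := mem_forwardTube_of_mem_tubeCone x η hη ht
  rw [tubeExtension_eq hinv (revConj_mem_relForwardTube hmem) (s := t * (1 + 2 * ∑ k, ‖η k‖))
    (by rw [revConj_ray_add_iTimeShift]
        exact mem_forwardTube_of_mem_tubeCone _ _ (revDir_mem_tubeCone hη) ht),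
    revConj_ray_add_iTimeShift]

/-- The **adjoint test function** `F*(x₁, …, xₙ) = conj F(xₙ, …, x₁)`
(`starTest (permTest Fin.revPerm F)`; Streater–Wightman (1964), (3-25)). [cite: StreaterWightman1964, §3-3 (3-25)] -/
theorem starTest_permTest_revPerm_apply (F : 𝓢((Fin n → SpaceTime d), ℂ)) (y : Fin n → SpaceTime d) :
    starTest (permTest Fin.revPerm F) y = conj (F fun k => y (Fin.rev k)) := by
  simp [Function.comp_def]

/-- The **adjoint distribution** `T†(F) = conj T(F*)`, `F* = starTest (permTest Fin.revPerm F)`,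
as a continuous linear functional (conjugate-linear twice). [folklore] -/
def adjointDistribution (T : 𝓢((Fin n → SpaceTime d), ℂ) →L[ℂ] ℂ) :
    𝓢((Fin n → SpaceTime d), ℂ) →L[ℂ] ℂ where
  toFun F := conj (T (starTest (permTest Fin.revPerm F)))
  map_add' F G := by simp
  map_smul' c F := by
    have : starTest (permTest Fin.revPerm (c • F)) = conj c • starTest (permTest Fin.revPerm F) := by
      ext y; simp
    rw [this, map_smul, smul_eq_mul, map_mul, Complex.conj_conj, RingHom.id_apply, smul_eq_mul]
  cont := Complex.continuous_conj.comp (T.continuous.comp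
    ((starTest (X := Fin n → SpaceTime d)).continuous.comp (permTest Fin.revPerm).continuous))

/-- `adjointDistribution T F = conj (T F*)`. [folklore] -/
@[simp]
theorem adjointDistribution_apply (T : 𝓢((Fin n → SpaceTime d), ℂ) →L[ℂ] ℂ)
    (F : 𝓢((Fin n → SpaceTime d), ℂ)) :
    adjointDistribution T F = conj (T (starTest (permTest Fin.revPerm F))) := rfl

/-- **Boundary value of the reflected continuation.** If `T` is the distributional boundary
value of `𝔚` (invariant under imaginary time shifts), then `T† = conj T(·*)` is the
distributional boundary value of `𝔚†`: along the ray `x + i t η` the approximating integral is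
the conjugate of the approximating integral of `𝔚` along the reversed ray against `F*`
(reindexing `x ↦ rev x` preserves Lebesgue measure). [cite: StreaterWightman1964, §3-3 (3-25)] -/
theorem _root_.Literature.MathematicalPhysics.QuantumLattice.HasDistributionalBoundaryValue.reflectFn
    (hinv : ∀ s : ℝ, 0 ≤ s → ∀ z ∈ forwardTube d n, 𝔚 (z + iTimeShift d n s) = 𝔚 z)
    {T : 𝓢((Fin n → SpaceTime d), ℂ) →L[ℂ] ℂ} (hT : HasDistributionalBoundaryValue 𝔚 T) :
    HasDistributionalBoundaryValue (reflectFn 𝔚) (adjointDistribution T) := by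
  intro η hη F
  set η' := revDir (1 + 2 * ∑ k, ‖η k‖) η with hη'
  have hη'c : η' ∈ tubeCone d n := revDir_mem_tubeCone hη
  have hlim := hT η' hη'c (starTest (permTest Fin.revPerm F))
  have hconj := (Complex.continuous_conj.tendsto _).comp hlim
  rw [adjointDistribution_apply]
  refine Tendsto.congr' ?_ hconj
  refine eventually_nhdsWithin_of_forall fun t (ht : 0 < t) => ?_
  simp only [Function.comp_apply]
  rw [← integral_conj]
  -- reindex `y = rev x`
  rw [← integral_comp_rev]
  congr 1
  funext x
  rw [reflectFn_ray hinv hη x ht, map_mul, starTest_permTest_revPerm_apply, Complex.conj_conj]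
  simp only [Fin.rev_rev]
  rfl

end Reflect


/-! ### The reflected continuation at Euclidean points -/

/-- The **reflected, time-shifted Euclidean configuration** `(φₛ x)_k = θ x_{n-1-k} + s ê₀`
(time reflection, reversal of the arguments, time shift by `s`): an involution of
`(ℝ^{d+1})^n` preserving Lebesgue measure, exchanging `F ↦ (ΘF*)(· − s ê₀)` with complex
conjugation (`translateMulti_osAdjoint_apply`). [folklore] -/
def thetaRevShift (s : ℝ) (x : Fin n → EuclideanSpace ℝ (Fin (d + 1))) :
    Fin n → EuclideanSpace ℝ (Fin (d + 1)) :=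
  fun k => timeReflection (d + 1) (x (Fin.rev k)) + EuclideanSpace.single 0 s

/-- Components of `thetaRevShift`. [folklore] -/
theorem thetaRevShift_apply (s : ℝ) (x : Fin n → EuclideanSpace ℝ (Fin (d + 1))) (k : Fin n)
    (μ : Fin (d + 1)) :
    thetaRevShift s x k μ = (if μ = 0 then -x (Fin.rev k) 0 + s else x (Fin.rev k) μ) := by
  by_cases hμ : μ = 0
  · subst hμ; simp [thetaRevShift]
  · simp [thetaRevShift, hμ]

/-- Time components of `thetaRevShift`: `(φₛ x)_k⁰ = s − x_{n-1-k}⁰`. [folklore] -/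
@[simp]
theorem thetaRevShift_apply_zero (s : ℝ) (x : Fin n → EuclideanSpace ℝ (Fin (d + 1))) (k : Fin n) :
    thetaRevShift s x k 0 = s - x (Fin.rev k) 0 := by
  rw [thetaRevShift_apply, if_pos rfl]; ring

/-- `thetaRevShift s` is an involution. [folklore] -/
@[simp]
theorem thetaRevShift_thetaRevShift (s : ℝ) (x : Fin n → EuclideanSpace ℝ (Fin (d + 1))) :
    thetaRevShift s (thetaRevShift s x) = x := by
  funext k; ext μ
  rw [thetaRevShift_apply]
  by_cases hμ : μ = 0
  · subst hμ; simp
  · simp [hμ, thetaRevShift_apply]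

/-- `thetaRevShift s` preserves Lebesgue measure (reversal, time reflection, translation). [folklore] -/
theorem integral_comp_thetaRevShift {G' : Type*} [NormedAddCommGroup G'] [NormedSpace ℝ G']
    (s : ℝ) (G : (Fin n → EuclideanSpace ℝ (Fin (d + 1))) → G') :
    ∫ x, G (thetaRevShift s x) = ∫ y, G y := by
  have h1 := integral_comp_rev (E := EuclideanSpace ℝ (Fin (d + 1)))
    (fun y => G (fun k => timeReflection (d + 1) (y k) + EuclideanSpace.single 0 s))
  have h2 := integral_comp_timeReflection (d := d) (n := n)
    (fun y => G (fun k => y k + EuclideanSpace.single 0 s))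
  have h3 := integral_add_right_eq_self (μ := volume) G
    (fun _ : Fin n => (EuclideanSpace.single 0 s : EuclideanSpace ℝ (Fin (d + 1))))
  simp only at h1 h2
  rw [show (fun x => G (thetaRevShift s x)) =
      fun x => G (fun k => timeReflection (d + 1) (x (Fin.rev k)) + EuclideanSpace.single 0 s)
    from rfl, h1, h2, ← h3]
  rfl

/-- The Euclidean point of `φₛ x` is the conjugate reversal of the Euclidean point of `x`,
shifted by `i s ê₀`. [folklore] -/
theorem euclideanPoint_thetaRevShift (s : ℝ) (x : Fin n → EuclideanSpace ℝ (Fin (d + 1))) :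
    euclideanPoint (thetaRevShift s x) = revConj (euclideanPoint x) + iTimeShift d n s := by
  funext k μ
  by_cases hμ : μ = 0
  · subst hμ
    simp [iTimeShift, thetaRevShift_apply, Complex.conj_ofReal]
    ring
  · simp [iTimeShift, euclideanPoint, hμ, thetaRevShift_apply, Complex.conj_ofReal]

/-- `φₛ` maps time-ordered configurations with all times `< s` to time-ordered configurations. [folklore] -/
theorem thetaRevShift_mem_timeOrderedRegion {s : ℝ} {x : Fin n → EuclideanSpace ℝ (Fin (d + 1))}
    (hx : x ∈ timeOrderedRegion d n) (hs : ∀ k, x k 0 < s) :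
    thetaRevShift s x ∈ timeOrderedRegion d n := by
  refine ⟨fun k => ?_, fun i j hij => ?_⟩
  · rw [thetaRevShift_apply_zero]; linarith [hs (Fin.rev k)]
  · simp only [thetaRevShift_apply_zero]
    have : x (Fin.rev j) 0 < x (Fin.rev i) 0 := hx.2 (Fin.rev_lt_rev.2 hij)
    linarith

/-- Times of `φₛ x` are `< s` when the times of `x` are positive. [folklore] -/
theorem thetaRevShift_apply_zero_lt {s : ℝ} {x : Fin n → EuclideanSpace ℝ (Fin (d + 1))}
    (hx : ∀ k, 0 < x k 0) (k : Fin n) : thetaRevShift s x k 0 < s := by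
  rw [thetaRevShift_apply_zero]; linarith [hx (Fin.rev k)]

/-- The time-shifted OS adjoint is conjugation composed with `φₛ`:
`(ΘF*)(z − s ê₀) = conj F(φₛ z)`. [folklore] -/
theorem translateMulti_osAdjoint_apply (s : ℝ) (F : 𝓢((Fin n → EuclideanSpace ℝ (Fin (d + 1))), ℂ))
    (z : Fin n → EuclideanSpace ℝ (Fin (d + 1))) :
    translateMulti (EuclideanSpace.single 0 s) (osAdjoint F) z = conj (F (thetaRevShift s z)) := by
  rw [translateMulti_apply, osAdjoint_apply]
  congr 2
  funext k; ext μ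
  rw [thetaRevShift_apply]
  by_cases hμ : μ = 0
  · subst hμ; simp
  · simp [hμ]

section ReflectEuclid

variable {𝔚 : (Fin n → Fin (d + 1) → ℂ) → ℂ}

/-- **The reflected continuation at time-ordered Euclidean points**:
`𝔚†(ι x) = conj 𝔚(ι(φₛ x))` for any `s` exceeding all times of `x`. [folklore] -/
theorem reflectFn_euclideanPoint
    (hinv : ∀ s : ℝ, 0 ≤ s → ∀ z ∈ forwardTube d n, 𝔚 (z + iTimeShift d n s) = 𝔚 z)
    {x : Fin n → EuclideanSpace ℝ (Fin (d + 1))} (hx : x ∈ timeOrderedRegion d n) {s : ℝ}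
    (hs : ∀ k, x k 0 < s) :
    reflectFn 𝔚 (euclideanPoint x) = conj (𝔚 (euclideanPoint (thetaRevShift s x))) := by
  rw [reflectFn]
  congr 1
  have hmem : euclideanPoint x ∈ forwardTube d n := euclideanPoint_mem_forwardTube hx.1 hx.2
  rw [tubeExtension_eq hinv (revConj_mem_relForwardTube hmem) (s := s)
    (by rw [← euclideanPoint_thetaRevShift]
        exact mapsTo_euclideanPoint_timeOrderedRegion (thetaRevShift_mem_timeOrderedRegion hx hs)),
    euclideanPoint_thetaRevShift]

end ReflectEuclid

/-- A compactly supported function has all time coordinates of its support below some `s`. [folklore] -/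
theorem exists_forall_apply_zero_lt {F : (Fin n → EuclideanSpace ℝ (Fin (d + 1))) → ℂ}
    (hF : HasCompactSupport F) : ∃ s : ℝ, ∀ x ∈ tsupport F, ∀ k, x k 0 < s := by
  obtain ⟨C, hC⟩ := hF.isCompact.isBounded.exists_norm_le
  refine ⟨C + 1, fun x hx k => ?_⟩
  have h1 : ‖x k 0‖ ≤ ‖x k‖ := PiLp.norm_apply_le (p := 2) (x k) 0
  have h2 : ‖x k‖ ≤ ‖x‖ := norm_le_pi_norm x k
  have h3 := hC x hx
  rw [Real.norm_eq_abs] at h1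
  linarith [le_abs_self (x k 0)]

/-- Compact-support version of `eqOn_timeOrderedRegion_of_integral_eq`: equality of the
integrals against *compactly supported* time-ordered test functions suffices (the proof of the
former only uses smooth bump functions). [folklore] -/
theorem eqOn_timeOrderedRegion_of_integral_eq_of_hasCompactSupport
    {G G' : (Fin n → EuclideanSpace ℝ (Fin (d + 1))) → ℂ}
    (hG : ContinuousOn G (timeOrderedRegion d n)) (hG' : ContinuousOn G' (timeOrderedRegion d n))
    (h : ∀ F : 𝓢((Fin n → EuclideanSpace ℝ (Fin (d + 1))), ℂ), QuantumLattice.IsTimeOrdered F →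
      HasCompactSupport (F : (Fin n → EuclideanSpace ℝ (Fin (d + 1))) → ℂ) →
      ∫ x, G x * F x = ∫ x, G' x * F x) :
    Set.EqOn G G' (timeOrderedRegion d n) := by
  have hU : IsOpen (timeOrderedRegion d n) := isOpen_timeOrderedRegion
  have hf : ContinuousOn (fun x => G x - G' x) (timeOrderedRegion d n) := hG.sub hG'
  have hae : ∀ᵐ x ∂(volume : Measure (Fin n → EuclideanSpace ℝ (Fin (d + 1)))),
      x ∈ timeOrderedRegion d n → G x - G' x = 0 := by
    refine hU.ae_eq_zero_of_integral_contDiff_smul_eq_zero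
      (hf.locallyIntegrableOn hU.measurableSet) fun g hg hgs hgU => ?_
    have hgs' : HasCompactSupport fun x => (g x : ℂ) := hgs.comp_left Complex.ofReal_zero
    have hgd' : ContDiff ℝ (⊤ : ℕ∞) fun x => (g x : ℂ) := ofRealCLM.contDiff.comp hg
    have hsupp : tsupport (fun x => (g x : ℂ)) ⊆ timeOrderedRegion d n :=
      (tsupport_comp_subset Complex.ofReal_zero g).trans hgU
    have hto : QuantumLattice.IsTimeOrdered (hgs'.toSchwartzMap hgd') := fun x hx => hsupp hx
    have hint := h _ hto hgs'
    have hI : ∀ {H : (Fin n → EuclideanSpace ℝ (Fin (d + 1))) → ℂ},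
        ContinuousOn H (timeOrderedRegion d n) → Integrable fun x => H x * (g x : ℂ) :=
      fun hH => (continuous_mul_of_tsupport_subset hU hH hgd'.continuous hsupp)
        |>.integrable_of_hasCompactSupport hgs'.mul_left
    calc ∫ x, g x • (G x - G' x) = ∫ x, (G x * (g x : ℂ) - G' x * (g x : ℂ)) := by
          congr 1; funext x; rw [Complex.real_smul]; ring
      _ = (∫ x, G x * (g x : ℂ)) - ∫ x, G' x * (g x : ℂ) := integral_sub (hI hG) (hI hG')
      _ = 0 := by rw [sub_eq_zero]; exact hint
  have hae' : (fun x => G x - G' x) =ᵐ[volume.restrict (timeOrderedRegion d n)] 0 := by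
    rw [Filter.EventuallyEq, ae_restrict_iff' hU.measurableSet]
    exact hae
  intro x hx
  exact sub_eq_zero.1 (Measure.eqOn_open_of_ae_eq hae' hU hf continuousOn_const hx)

section ReflectSchwinger

variable {S : SchwingerFamily (EuclideanSpace ℝ (Fin (d + 1)))} {𝔚 : (Fin n → Fin (d + 1) → ℂ) → ℂ}

/-- **Imaginary time shifts act trivially on the continued Schwinger functions** (E1, time
translations, read at Euclidean points; cf. `eqOn_forwardTube_add_euclideanShift`). [folklore] -/
theorem eqOn_forwardTube_add_iTimeShift (hE1 : S.IsEuclideanCovariant)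
    (h𝔚 : DifferentiableOn ℂ 𝔚 (forwardTube d n))
    (hS : ∀ F : 𝓢((Fin n → EuclideanSpace ℝ (Fin (d + 1))), ℂ), IsTimeOrdered F →
      S n F = ∫ x, 𝔚 (euclideanPoint x) * F x) :
    ∀ s : ℝ, 0 ≤ s → ∀ z ∈ forwardTube d n, 𝔚 (z + iTimeShift d n s) = 𝔚 z := fun s hs =>
  eqOn_forwardTube_add_euclideanShift _ (fun F => hE1.translateMulti n _ F) h𝔚 hS
    (fun _ hz => add_euclideanTimeShift_mem_forwardTube hz hs)
    (fun _ hF => hF.translateMulti_of_nonneg (by simpa using hs))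

/-- **The reflected continuation has the same Euclidean integrals** against compactly supported
time-ordered test functions: `∫ 𝔚†(ιx) F(x) dx = conj ∫ 𝔚(ι φₛx) conj F(x) dx =
conj ∫ 𝔚(ιy) (ΘF*)(y − sê₀) dy = conj 𝔖ₙ((ΘF*)(· − sê₀)) = conj 𝔖ₙ(ΘF*) = 𝔖ₙ(F)` by the
change of variables `y = φₛ x`, E1 and the reality `𝔖ₙ(ΘF*) = conj 𝔖ₙ(F)` (E2). [cite: OsterwalderSchraderCMP1973, §4.3] -/
theorem integral_reflectFn_euclideanPoint_mul [NeZero d] (hOS : S.IsOSFamily)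
    (h𝔚 : DifferentiableOn ℂ 𝔚 (forwardTube d n))
    (hS : ∀ F : 𝓢((Fin n → EuclideanSpace ℝ (Fin (d + 1))), ℂ), IsTimeOrdered F →
      S n F = ∫ x, 𝔚 (euclideanPoint x) * F x)
    {F : 𝓢((Fin n → EuclideanSpace ℝ (Fin (d + 1))), ℂ)} (hF : IsTimeOrdered F)
    (hFc : HasCompactSupport (F : (Fin n → EuclideanSpace ℝ (Fin (d + 1))) → ℂ)) :
    ∫ x, reflectFn 𝔚 (euclideanPoint x) * F x = ∫ x, 𝔚 (euclideanPoint x) * F x := by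
  have hinv := eqOn_forwardTube_add_iTimeShift hOS.covariant h𝔚 hS
  obtain ⟨s, hs⟩ := exists_forall_apply_zero_lt hFc
  -- Step 1: pointwise on the support
  have h1 : (fun x => reflectFn 𝔚 (euclideanPoint x) * F x) =
      fun x => conj (𝔚 (euclideanPoint (thetaRevShift s x)) * conj (F (thetaRevShift s (thetaRevShift s x)))) := by
    funext x
    by_cases hx : x ∈ tsupport (F : (Fin n → EuclideanSpace ℝ (Fin (d + 1))) → ℂ)
    · rw [reflectFn_euclideanPoint hinv (hF hx) (hs x hx), thetaRevShift_thetaRevShift, map_mul,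
        Complex.conj_conj]
    · rw [image_eq_zero_of_notMem_tsupport hx, thetaRevShift_thetaRevShift,
        image_eq_zero_of_notMem_tsupport hx]
      simp
  -- Step 2: change of variables `y = φₛ x`, and the shifted OS adjoint
  set G : 𝓢((Fin n → EuclideanSpace ℝ (Fin (d + 1))), ℂ) :=
    translateMulti (EuclideanSpace.single 0 s) (osAdjoint F) with hG
  have h2 : ∫ x, reflectFn 𝔚 (euclideanPoint x) * F x = conj (∫ y, 𝔚 (euclideanPoint y) * G y) := by
    rw [h1, integral_conj, integral_comp_thetaRevShift s
      (fun y => 𝔚 (euclideanPoint y) * conj (F (thetaRevShift s y)))]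
    simp only [hG, translateMulti_osAdjoint_apply]
  -- Step 3: `G` is time-ordered
  have hGto : IsTimeOrdered G := by
    intro z hz
    have hz' : thetaRevShift s z ∈ tsupport (F : (Fin n → EuclideanSpace ℝ (Fin (d + 1))) → ℂ) := by
      have hcomp : ((G : 𝓢(_, ℂ)) : (Fin n → EuclideanSpace ℝ (Fin (d + 1))) → ℂ) =
          (conj ∘ (F : (Fin n → EuclideanSpace ℝ (Fin (d + 1))) → ℂ)) ∘ thetaRevShift s := by
        funext y; exact translateMulti_osAdjoint_apply s F y
      have hhomeo : Continuous (thetaRevShift (d := d) (n := n) s) := by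
        refine continuous_pi fun k => ?_
        show Continuous fun a : Fin n → EuclideanSpace ℝ (Fin (d + 1)) =>
          timeReflection (d + 1) (a (Fin.rev k)) + EuclideanSpace.single 0 s
        exact ((timeReflection (d + 1)).continuous.comp (continuous_apply (Fin.rev k))).add
          continuous_const
      rw [hcomp] at hz
      have := tsupport_comp_subset_preimage _ hhomeo hz
      rw [Set.mem_preimage] at this
      have hconj : tsupport (conj ∘ (F : (Fin n → EuclideanSpace ℝ (Fin (d + 1))) → ℂ)) =
          tsupport (F : (Fin n → EuclideanSpace ℝ (Fin (d + 1))) → ℂ) := by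
        unfold tsupport
        rw [Function.support_comp_eq (starRingEnd ℂ) (map_eq_zero_iff _ (RingHom.injective _))]
      rwa [hconj] at this
    have := thetaRevShift_mem_timeOrderedRegion (hF hz') (hs _ hz')
    rwa [thetaRevShift_thetaRevShift] at this
  -- Step 4: E1 and reality
  rw [h2, ← hS G hGto, hG, hOS.covariant.translateMulti, hOS.apply_osAdjoint hF.isPositiveTimeMulti,
    Complex.conj_conj, hS F hF]

/-- **The reflected continuation coincides with the continuation** on the forward tube
(identity theorem from the time-ordered Euclidean points). [folklore] -/
theorem reflectFn_eqOn [NeZero d] (hOS : S.IsOSFamily) (h𝔚 : DifferentiableOn ℂ 𝔚 (forwardTube d n))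
    (hS : ∀ F : 𝓢((Fin n → EuclideanSpace ℝ (Fin (d + 1))), ℂ), IsTimeOrdered F →
      S n F = ∫ x, 𝔚 (euclideanPoint x) * F x) :
    Set.EqOn (reflectFn 𝔚) 𝔚 (forwardTube d n) := by
  have hinv := eqOn_forwardTube_add_iTimeShift hOS.covariant h𝔚 hS
  have hdiff := differentiableOn_reflectFn h𝔚 hinv
  refine eqOn_forwardTube_of_euclidean hdiff h𝔚 ?_
  have hcont : ∀ {G : (Fin n → Fin (d + 1) → ℂ) → ℂ}, DifferentiableOn ℂ G (forwardTube d n) →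
      ContinuousOn (fun x => G (euclideanPoint x)) (timeOrderedRegion d n) := fun hG =>
    hG.continuousOn.comp continuous_euclideanPoint.continuousOn
      mapsTo_euclideanPoint_timeOrderedRegion
  exact eqOn_timeOrderedRegion_of_integral_eq_of_hasCompactSupport (hcont hdiff) (hcont h𝔚)
    fun F hF hFc => integral_reflectFn_euclideanPoint_mul hOS h𝔚 hS hF hFc

/-- **Hermiticity of the boundary values** on the level of one distribution:
`T(F*) = conj T(F)`. [cite: OsterwalderSchraderCMP1973, §3 p. 88 (R0–R5 incl. hermiticity)] -/
theorem _root_.Literature.MathematicalPhysics.QuantumLattice.HasDistributionalBoundaryValue.apply_starTest_permTest [NeZero d] (hOS : S.IsOSFamily)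
    (h𝔚 : DifferentiableOn ℂ 𝔚 (forwardTube d n)) {T : 𝓢((Fin n → SpaceTime d), ℂ) →L[ℂ] ℂ}
    (hT : HasDistributionalBoundaryValue 𝔚 T)
    (hS : ∀ F : 𝓢((Fin n → EuclideanSpace ℝ (Fin (d + 1))), ℂ), IsTimeOrdered F →
      S n F = ∫ x, 𝔚 (euclideanPoint x) * F x)
    (F : 𝓢((Fin n → SpaceTime d), ℂ)) :
    T (starTest (permTest Fin.revPerm F)) = conj (T F) := by
  have hinv := eqOn_forwardTube_add_iTimeShift hOS.covariant h𝔚 hS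
  have hT' := hT.reflectFn hinv
  have heq : adjointDistribution T = T := hT'.eq_of_eqOn hT (reflectFn_eqOn hOS h𝔚 hS)
  have := congrArg (fun L => L F) heq
  simp only [adjointDistribution_apply] at this
  rw [← this, Complex.conj_conj]

end ReflectSchwinger

end Literature.MathematicalPhysics.QuantumFieldTheory

namespace Literature.MathematicalPhysics.QuantumFieldTheory

variable {d : ℕ} {S : SchwingerFamily (EuclideanSpace ℝ (Fin (d + 1)))} {𝒲 : Literature.Analysis.FunctionSpaces.WightmanFamily d Unit}

/-- **Hermiticity of an OS continuation family** (property (c), `IsHermitianFamily`) from E1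
and E2: `𝒲ₙ(F*) = conj 𝒲ₙ(F)`. Real proof (`Literature.MathematicalPhysics.QuantumLattice.HasDistributionalBoundaryValue.apply_starTest_permTest`). [cite: OsterwalderSchraderCMP1973, §3 p. 88 (R0–R5 incl. hermiticity)] -/
theorem IsOSContinuationFamily.isHermitianFamily [NeZero d] (hOS : S.IsOSFamily)
    (h : IsOSContinuationFamily S 𝒲) : Literature.Analysis.FunctionSpaces.IsHermitianFamily 𝒲 := by
  intro n k F
  obtain rfl := unitLabels_eq k
  have hk : ((fun _ => ()) ∘ Fin.rev : Fin n → Unit) = fun _ => () := rfl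
  rw [hk]
  obtain ⟨𝔚, h𝔚, hbv, hS⟩ := h n
  exact hbv.apply_starTest_permTest hOS h𝔚 hS F

/-- **Discharge of `OS1973_hermitian`** (Osterwalder–Schrader I (1973), p. 88: hermiticity is
among the Wightman axioms established by E→R; here from E1 (imaginary time shifts act
trivially on the continuation), E2 (reality `𝔖ₙ(ΘF*) = conj 𝔖ₙ(F)`), the reflected
continuation `𝔚†(w) = conj 𝔚ext(revConj w)` with boundary value `conj 𝒲ₙ(·*)` and the same
Euclidean restriction as `𝔚`, the identity theorem on the forward tube and uniqueness of
boundary values). [cite: OsterwalderSchraderCMP1973, §3 p. 88 (R0–R5 incl. hermiticity)] -/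
theorem OS1973_hermitian_holds : OS1973_hermitian :=
  fun _ _ _ hOS _ _ h => h.isHermitianFamily hOS

end Literature.MathematicalPhysics.QuantumFieldTheory

namespace Literature.MathematicalPhysics.QuantumFieldTheory

/-! ## Lorentz invariance (discharged) -/

variable {d : ℕ} {S : SchwingerFamily (EuclideanSpace ℝ (Fin (d + 1)))} {𝒲 : Literature.Analysis.FunctionSpaces.WightmanFamily d Unit}

/-- **Lorentz invariance of an OS continuation family** from E1: `𝒲ₙ` is invariant under the
diagonal action of every `Λ ∈ L↑₊` (`OSLorentzInvariance`:
`Literature.MathematicalPhysics.QuantumLattice.HasDistributionalBoundaryValue.poincareTestMulti_inr_eq`). Real proof. [cite: OsterwalderSchraderCMP1973, §4.2 eqs. (4.14)–(4.15)] -/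
theorem IsOSContinuationFamily.poincareTestMulti_inr_eq [NeZero d] (hE1 : S.IsEuclideanCovariant)
    (h : IsOSContinuationFamily S 𝒲) (Λ : restrictedLorentzGroup d) (n : ℕ) (k : Fin n → Unit)
    (F : 𝓢((Fin n → SpaceTime d), ℂ)) :
    𝒲 n k (poincareTestMulti n (SemidirectProduct.inr Λ) F) = 𝒲 n k F := by
  obtain rfl := unitLabels_eq k
  obtain ⟨𝔚, h𝔚, hbv, hS⟩ := h n
  exact hbv.poincareTestMulti_inr_eq hE1 h𝔚 hS Λ F

/-- **Poincaré invariance (property (a)) of an OS continuation family** from E1: translations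
(`IsOSContinuationFamily.translateMulti_eq`) and restricted Lorentz transformations
(`IsOSContinuationFamily.poincareTestMulti_inr_eq`). Real proof. [cite: OsterwalderSchraderCMP1973, §4.2] -/
theorem IsOSContinuationFamily.isPoincareInvariantFamily [NeZero d] (hE1 : S.IsEuclideanCovariant)
    (h : IsOSContinuationFamily S 𝒲) : Literature.Analysis.FunctionSpaces.IsPoincareInvariantFamily 𝒲 :=
  h.isPoincareInvariantFamily_of_lorentz hE1 (h.poincareTestMulti_inr_eq hE1)

/-- **Discharge of `OS1973_lorentzInvariant`** (Osterwalder–Schrader I (1973), §4.2: R1 from the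
Euclidean rotation invariance E1; here by analytic continuation in the group parameters rather
than through the infinitesimal generators (4.14)–(4.15), see `OSLorentzInvariance`). [cite: OsterwalderSchraderCMP1973, §4.2 eqs. (4.14)–(4.15)] -/
theorem OS1973_lorentzInvariant_holds : OS1973_lorentzInvariant :=
  fun _ _ _ hS _ _ h Λ n k F => h.poincareTestMulti_inr_eq hS.covariant Λ n k F

/-! ## Wightman reconstruction discharged (`d ≥ 1`) -/

/-- **Assembly of `os_reconstruction` needing Wightman reconstruction only for `d ≥ 1`**
(same proof as `os_reconstruction_of_parts`; `os_reconstruction` itself quantifies over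
`d ≥ 1`, and the Wightman reconstruction theorem is only true for `d ≥ 1`, the uniqueness of
the vacuum failing in `0 + 1` dimensions where the cluster property is vacuous). Real proof. [cite: OsterwalderSchraderCMP1975, §IV.1 Thm. E'→R'] -/
theorem os_reconstruction_of_parts' (hA : OS1975_exists_wightmanFamily)
    (hB : ∀ d : ℕ, [NeZero d] → Literature.Analysis.FunctionSpaces.wightman_reconstruction (d := d))
    (hC : wightmanFn_eq_of_isWickRotationOf) : os_reconstruction := by
  intro d _ S hS hE0'
  obtain ⟨𝒲, h𝒲, hcont⟩ := hA d S hS hE0'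
  obtain ⟨W, hW, hmin, hdist, huniq⟩ := hB d h𝒲
  have hwick : IsWickRotationOf S W (fun _ _ => ()) := fun n => by
    obtain ⟨𝔚, h𝔚, hbv, hS'⟩ := hcont n
    exact ⟨𝔚, h𝔚, ⟨𝒲 n fun _ => (), hdist n _, hbv⟩, hS'⟩
  refine ⟨W, hW, hmin, hwick, fun W' hW' hmin' hwick' => huniq W' hW' hmin' fun n k => ?_⟩
  obtain rfl : k = fun _ => () := funext fun _ => rfl
  intro f F hF
  rw [hdist n _ f F hF]
  exact hC hwick hwick' n f

/-- **`os_reconstruction` from (A) `OS1975_exists_wightmanFamily` alone**: the Wightman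
reconstruction theorem is now a theorem for `d ≥ 1` (`Literature.Analysis.FunctionSpaces.wightman_reconstruction_holds`,
`WightmanGNSSpectral`: GNS construction, strong continuity, uniqueness of the vacuum by the
mean ergodic theorem, spectral condition by the exchange theorem), as is the uniqueness of the
Wightman functions with a given Wick rotation (`wightmanFn_eq_of_isWickRotationOf_holds`).
Real proof. [cite: OsterwalderSchraderCMP1975, §IV.1 Thm. E'→R'] -/
theorem os_reconstruction_of_exists_wightmanFamily (hA : OS1975_exists_wightmanFamily) :
    os_reconstruction :=
  os_reconstruction_of_parts' hA (fun _ _ => Literature.Analysis.FunctionSpaces.wightman_reconstruction_holds)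
    wightmanFn_eq_of_isWickRotationOf_holds

/-- **`os_reconstruction` from the remaining named facts**: the analytic continuation (A₁₂,
OS II Thms. 4.1–4.3) and the four Wightman properties of the boundary values not yet proved here
— (b) spectral condition, (d) locality, (e) positivity, (f) cluster property (OS I §4.1,
§4.3–4.5); everything else ((a) Lorentz and translation invariance, (c) hermiticity, `𝒲₀ = 1`,
Wightman reconstruction, uniqueness of the Wightman functions) is a theorem. Real proof. [cite: OsterwalderSchraderCMP1975, §IV.2] -/
theorem os_reconstruction_of_remaining (hA₁₂ : OS1975_exists_forwardTube_continuation)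
    (hR5 : OS1973_spectralCondition) (hR3 : OS1973_local) (hR2 : OS1973_positiveDefinite)
    (hR4 : OS1973_cluster) : os_reconstruction :=
  os_reconstruction_of_exists_wightmanFamily
    (OS1975_exists_wightmanFamily_of_parts hA₁₂
      (OS1973_isWightmanFamily_of_continuation_of_parts OS1973_lorentzInvariant_holds hR5
        OS1973_hermitian_holds hR3 hR2 hR4))

end Literature.MathematicalPhysics.QuantumFieldTheory

/-! ## (b) The spectral condition, modulo the half-space support of OS's Laplace representation

Osterwalder–Schrader I (1973), §4.1, p. 93: the Fourier transform `W̃ₙ` of the difference-variable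
Wightman distribution has support in the half-spaces `{q_k⁰ ≥ 0}` (from the Fourier–Laplace
representation (4.12); under E0' this is OS II (1975), Thm. 4.3 and p. 289), and "In Section 4.2
we prove that for `Λ ∈ L↑₊`, `W̃ₙ(Λq₁, …, Λqₙ) = W̃ₙ(q₁, …, qₙ)`. Hence the support of `W̃ₙ` is in
`{q_k ∈ V̄₊}` … This is the spectrum condition (R5)." The "Hence" is the theorem
`Literature.MathematicalPhysics.QuantumFieldTheory.fourierSupportedIn_spectralSet_of_lorentzInvariant` (`LorentzSpectralSupport`), and the
Lorentz invariance is proved (`OSLorentzInvariance`); so R5 (`OS1973_spectralCondition`) follows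
from the half-space support alone, which is recorded — together with the continuation it refers
to — as the named fact `OS1975_exists_continuation_halfSpace` (A₁₂⁺). With it,
`os_reconstruction` needs only (A₁₂⁺), (d) locality, (e) positivity and (f) the cluster property
(`os_reconstruction_of_remaining'`).
-/

namespace Literature.MathematicalPhysics.QuantumFieldTheory

open QuantumLattice MeasureTheory

/-- **(A₁₂⁺) The OS analytic continuation with the half-space support of its Fourier–Laplace
representation** (Osterwalder–Schrader I (1973), §4.1, eqs. (4.12)–(4.13) and p. 93, first
sentence after (4.13): "`W̃ₙ(q₁, …, qₙ)` is a distribution in `𝒮′(ℝ^{4n})` with support in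
`{q₁, …, qₙ : q₁⁰ ≥ 0, …, qₙ⁰ ≥ 0}`"; under the linear growth condition E0' the continuation and
this representation are Osterwalder–Schrader II (1975), §IV.2, Thm. 4.3 and the text following
it, p. 289: by Vladimirov's Laplace-transform theorem there exist unique tempered distributions
`W̃_k`, supported in `{q⁰ ≥ 0}` in each time-momentum, of which the `S_k` are the Fourier–Laplace
transforms, and "As in OS I we conclude that `W̃_k` is the Fourier transform of the difference
variable Wightman distribution `W_k`", with the temperedness estimate (4.7)). *Statement in H21's
vocabulary.* For a Schwinger family `S` on `ℝ^{d+1}`,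
`d ≥ 1`, with `𝔖₀ = 1`, E1–E4 and E0', there is a family `𝒲` of tempered distributions (one
scalar field) such that (i) `𝒲` is an OS continuation family of `S` (`IsOSContinuationFamily`:
each `𝒲ₙ` is the distributional boundary value of a function holomorphic on the forward tube
`𝒯ₙ` whose Euclidean restriction is `𝔖ₙ` on time-ordered test functions) and (ii) the Fourier
transform of each `𝒲ₙ` is supported in the **half-space spectral set**
`{∑ⱼ pⱼ = 0, (∑_{j ≤ k} pⱼ)⁰ ≥ 0}` (`FourierSupportedIn (𝒲 n k) (halfSpectralSet d n)`,
`LorentzSpectralSupport`: the test-function form of `HasSpectralCondition` with `V̄₊` replaced by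
`{q⁰ ≥ 0}`, in the momenta `pⱼ` and the sign convention of `spectralSet`, `WightmanFunctions`).
Clause (i) alone is the accepted fact `OS1975_exists_forwardTube_continuation`
(`OS1975_exists_forwardTube_continuation_of_halfSpace`); since an OS continuation family is
unique (`IsOSContinuationFamily.unique`, proved), (i) and (ii) concern the same `𝒲`, the `Wₙ`
of OS I (4.13). In OS's order of proof (ii) precedes the forward-cone support (R5, obtained from
(ii) and Lorentz invariance, p. 93) and the holomorphy on the full forward tube
(Streater–Wightman Thm. 3-5); here R5 is *derived* from this fact and the proved Lorentz
invariance (`OS1973_spectralCondition_of_halfSpace`). Hypotheses as in the parent fact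
`os_reconstruction` (stronger than OS's). Known theorem (the analytic core of OS II, Ch. V–VI);
proof deferred. [cite: OsterwalderSchraderCMP1973, §4.1 eqs. (4.12)–(4.13) and p. 93] [cite: OsterwalderSchraderCMP1975, §IV.2 Thm. 4.3 and (4.7), p. 289] -/
def OS1975_exists_continuation_halfSpace : Prop :=
  ∀ (d : ℕ) [NeZero d] (S : SchwingerFamily (EuclideanSpace ℝ (Fin (d + 1)))),
    S.IsOSFamily → S.HasLinearGrowth → ∃ 𝒲 : Literature.Analysis.FunctionSpaces.WightmanFamily d Unit,
      IsOSContinuationFamily S 𝒲 ∧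
        ∀ (n : ℕ) (k : Fin n → Unit), FourierSupportedIn (𝒲 n k) (halfSpectralSet d n)

/-- (A₁₂⁺) implies (A₁₂) `OS1975_exists_forwardTube_continuation` (forget clause (ii)). Real
proof. [folklore] -/
theorem OS1975_exists_forwardTube_continuation_of_halfSpace
    (h : OS1975_exists_continuation_halfSpace) : OS1975_exists_forwardTube_continuation := by
  intro d _ S hS hE0' n
  obtain ⟨𝒲, hcont, -⟩ := h d S hS hE0'
  obtain ⟨𝔚, h𝔚, hbv, hS'⟩ := hcont n
  exact ⟨𝔚, 𝒲 n fun _ => (), h𝔚, hbv, hS'⟩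

variable {d : ℕ} {S : SchwingerFamily (EuclideanSpace ℝ (Fin (d + 1)))} {𝒲 : Literature.Analysis.FunctionSpaces.WightmanFamily d Unit}

/-- **An OS continuation family is invariant under the restricted Lorentz group**, in the
witness form `IsLorentzInvariantDistribution` of `LorentzSpectralSupport`
(`HasDistributionalBoundaryValue.lorentz_eq`, `OSLorentzInvariance`, from E1 — which gives even
the orthochronous group). Real proof. [cite: OsterwalderSchraderCMP1973, §4.2] -/
theorem IsOSContinuationFamily.isLorentzInvariantDistribution [NeZero d]
    (hE1 : S.IsEuclideanCovariant) (h : IsOSContinuationFamily S 𝒲) (n : ℕ) (k : Fin n → Unit) :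
    IsLorentzInvariantDistribution (𝒲 n k) := by
  intro Λ hΛ F G hG
  obtain rfl := unitLabels_eq k
  obtain ⟨𝔚, h𝔚, hbv, hS⟩ := h n
  have hm := (mem_restrictedLorentzGroup_iff _).1 hΛ
  exact hbv.lorentz_eq hE1 h𝔚 hS hm.1 hm.2.1 hG

/-- **(R5) The spectral condition of the OS boundary values, from (A₁₂⁺)**
(Osterwalder–Schrader I (1973), §4.1 p. 93): the continuation family of `S` is the family of
(A₁₂⁺) (uniqueness), it is Lorentz invariant (proved from E1), and Lorentz invariance upgrades
the half-space support (ii) to support in the spectral set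
(`WightmanFamily.hasSpectralCondition_of_halfSpace`). Real proof: `OS1973_spectralCondition` is
thereby reduced to (A₁₂⁺). [cite: OsterwalderSchraderCMP1973, §4.1 p. 93] -/
theorem OS1973_spectralCondition_of_halfSpace (h : OS1975_exists_continuation_halfSpace) :
    OS1973_spectralCondition := by
  intro d _ S hS hE0' 𝒲 h𝒲
  obtain ⟨𝒲', h𝒲', hhalf⟩ := h d S hS hE0'
  obtain rfl : 𝒲 = 𝒲' := h𝒲.unique h𝒲'
  exact 𝒲.hasSpectralCondition_of_halfSpace
    (fun n k => h𝒲.isLorentzInvariantDistribution hS.covariant n k) hhalf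

/-- **`os_reconstruction` from (A₁₂⁺) and the three remaining Wightman properties** — (d)
locality (OS I §4.5), (e) positivity (§4.3), (f) cluster property (§4.4); the analytic
continuation enters through (A₁₂⁺), and (a), (b), (c), `𝒲₀ = 1`, Wightman reconstruction and
uniqueness are theorems. Real proof. [cite: OsterwalderSchraderCMP1975, §IV.2] -/
theorem os_reconstruction_of_remaining' (hA : OS1975_exists_continuation_halfSpace)
    (hR3 : OS1973_local) (hR2 : OS1973_positiveDefinite) (hR4 : OS1973_cluster) :
    os_reconstruction :=
  os_reconstruction_of_remaining (OS1975_exists_forwardTube_continuation_of_halfSpace hA)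
    (OS1973_spectralCondition_of_halfSpace hA) hR3 hR2 hR4

end Literature.MathematicalPhysics.QuantumFieldTheory
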